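import Mathlib.RingTheory.Polynomial.Hermite.Basic
import Mathlib.Analysis.Polynomial.Basic
import Mathlib.Algebra.Polynomial.Splits
import Mathlib.Algebra.Polynomial.Degree.Lemmas
import Mathlib.Topology.Algebra.Polynomial
import Mathlib.Topology.UniformSpace.LocallyUniformConvergence
import Mathlib.Topology.MetricSpace.Bounded
import Mathlib.Algebra.Group.ForwardDiff
import Mathlib.Analysis.Asymptotics.Lemmas
import Mathlib.Analysis.Complex.Exponential
import Mathlib.Analysis.SpecialFunctions.Log.Basic
import Literature.NumberTheory.LFunctions.RiemannXi
import HarnessLib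

/-!
# Jensen polynomials with Hermite limits (Griffin–Ono–Rolen–Zagier 2019, Thms. 3, 6, Cor.) — proved

Trunk T-ANT (`Literature/NumberTheory/LFunctions`); serves the named fact `Literature.NumberTheory.LFunctions.gorz_eventually`
(`Equivalents.lean`, **rh.S39**: GORZ Thm. 1, "`J^{d,n}_γ` is hyperbolic for all sufficiently large
`n`") by proving everything in its printed proof that is elementary, and isolating the analytic
input as ONE named fact.

Source: M. Griffin, K. Ono, L. Rolen, D. Zagier, *Jensen polynomials for the Riemann zeta function
and other sequences*, PNAS 116 (2019) 11103–11110 = arXiv:1902.07321 [GORZPNAS2019]; theorem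
numbers as printed (Thm. 1, Thm. 3 with eqs. (4)–(5), Corollary, all §1 p. 3 of the arXiv version;
Thm. 6 and its proof §2 p. 6; §5.1 eqs. (15)–(18) p. 10).

## Contents (all `theorem`s fully proved; one `def … : Prop` named fact)

* `Literature.gorzHermite d` — the Hermite polynomials `H_d(X)` in GORZ's normalisation
  `∑ H_d t^d/d! = e^{-t²+Xt}` (eq. (3)), as the case `c = expNegSqCoeff` of the closed form
  `Literature.gorzHermiteGen c m = m! ∑_k (-1)^{m-k} c_{m-k} X^k/k!` of Thm. 6; recurrence
  `gorzHermite_add_two`, first values, and the link `coeff_gorzHermite_eq_coeff_hermite` with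
  Mathlib's `Polynomial.hermite` (`H_d(X) = 2^{d/2} He_d(X/√2)`).
* `Literature.NumberTheory.LFunctions.gorzHermite_eq_prod_roots` — `H_d = ∏_{i<d} (X - rᵢ)`, `r₀ < ⋯ < r_{d-1}`: real simple zeros,
  by the classical interlacing induction (`Literature.NumberTheory.LFunctions.Interlaces.step`, IVT).
* `Literature.NumberTheory.LFunctions.eventually_splits_of_tendsto_coeff` — polynomials of degree `≤ d` converging coefficientwise
  to one with `d` simple real zeros eventually split over `ℝ` ("invariant under small deformation").
* `Literature.jensenPolyRescaled α E δ d n = δ(n)^{-d}/α(n) · J^{d,n}_α((δ(n)X - 1)/E(n))` (eq. (5)) and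
  **Thm. 6** `Literature.NumberTheory.LFunctions.tendsto_coeff_jensenPolyRescaled`: hypothesis (8) ⇒ coefficientwise convergence
  to `H_{F,d}`, proved as printed via forward differences (Mathlib `fwdDiff_iter_eq_sum_shift`,
  `fwdDiff_iter_pow_eq_zero_of_lt`, `fwdDiff_iter_eq_factorial`).
* **Thm. 3** `Literature.NumberTheory.LFunctions.tendsto_coeff_jensenPolyRescaled_gorzHermite` (as printed, hypothesis (4)) and
  `…_gorzHermite'` (hypothesis (15) of §5.1, with the extra `gᵢ(n) jⁱ`, `gᵢ = o(δ^i)`), reduced to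
  Thm. 6 by `Literature.NumberTheory.LFunctions.isLittleO_expLogRatio_sub_taylor` (exponentiate the expansion of `log`).
* **Corollary** `Literature.NumberTheory.LFunctions.jensenPoly_eventually_splits` (as printed) / `…_splits'` (for (15)):
  `∃ N, ∀ n ≥ N, (jensenPoly α d n).Splits`.
* NAMED FACT `Literature.NumberTheory.LFunctions.xiTaylorCoeff_logRatio` = §5.1 eq. (15) for `γ = xiTaylorCoeff` (the output of the
  saddle-point analysis, Thm. 7), and **Thm. 1 conditionally**:
  `Literature.jensenPoly_xiTaylorCoeff_eventually_splits (hpos : xiTaylorCoeff_pos)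
  (h : xiTaylorCoeff_logRatio) (d ≥ 1) : ∃ N, ∀ n ≥ N, (jensenPoly xiTaylorCoeff d n).Splits`,
  which is `Literature.NumberTheory.LFunctions.gorz_eventually` unfolded (assembled in `EquivalentsProofs.lean`).

## Design choices

* "Hyperbolic" = `Polynomial.Splits` over `ℝ`, as in `RiemannXi.lean`/`Equivalents.lean`.
* Thms. 3/6 conclude "uniformly for `X` in compact subsets of `ℝ`"; for polynomials of degree `≤ d`
  this is equivalent to convergence of each coefficient, which is what the main statements give
  (and what the Corollary uses); `Literature.NumberTheory.LFunctions.tendstoLocallyUniformly_eval_of_tendsto_coeff` converts back,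
  and `Literature.NumberTheory.LFunctions.tendstoLocallyUniformly_jensenPolyRescaled_gorzHermite` is Thm. 3 with the printed
  conclusion (5) (`TendstoLocallyUniformly`).
* Faithfulness note on §5.1: eq. (15) carries terms `gᵢ(n) jⁱ` with `gᵢ(n) = o(δ(n)^i)`, which are
  NOT `o(δ(n)^d)` for `i < d`, so (15) is not literally hypothesis (4) of Thm. 3; the paper's own
  Thm. 6 is the right tool (`exp` of (15) has the shape (8) with `Cᵢ(n) → [tⁱ]e^{-t²}`), and that
  is the route proved here (`tendsto_coeff_jensenPolyRescaled_gorzHermite'`). The named fact states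
  (15) existentially in `A, δ, g` (weaker than the explicit (18)).
* Positivity: Thm. 3 assumes `α, A, δ > 0`; we use `α(n) > 0` (needed: `log`), `δ(n) > 0` only
  eventually, and no sign condition on `A(n)` (it enters through `exp(A(n)) > 0` only).
* What remains for an unconditional `gorz_eventually`: discharge `xiTaylorCoeff_pos` (classical,
  `Ξ(t) = ∫ Φ(u) cos(ut) du` with `Φ > 0`) and `xiTaylorCoeff_logRatio` (GORZ Thm. 7: Riemann's
  formula (11)–(13) for `Λ⁽ⁿ⁾(1/2)` and the saddle point for `F(n)` to all orders) — research-size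
  analysis, deliberately left as named facts.

Mathlib has `Polynomial.hermite` (probabilists' `He_n`, over `ℤ`) with coefficient formulas but no
real-rootedness, and no Jensen polynomials (searched `hermite`, `Jensen`, `interlac`, `real_roots`).

## References

* M. Griffin, K. Ono, L. Rolen, D. Zagier, *Jensen polynomials for the Riemann zeta function and
  other sequences*, PNAS 116 (2019), no. 23, 11103–11110; arXiv:1902.07321. [GORZPNAS2019]
* G. Szegő, *Orthogonal Polynomials*, AMS Colloq. Publ. 23, 4th ed. (1975), §3.3 (zeros of
  orthogonal polynomials; interlacing).
* G. Pólya, *Über die algebraisch-funktionentheoretischen Untersuchungen von J. L. W. V. Jensen*,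
  1927 (Jensen polynomials and RH).
-/

noncomputable section

open Polynomial Finset Filter Topology Asymptotics
open scoped Nat fwdDiff

namespace Literature.NumberTheory.LFunctions

/-! ### Taylor coefficients of `e^{-t²}` and the GORZ Hermite polynomials -/

/-- The `i`-th Taylor coefficient `cᵢ = [tⁱ] e^{-t²}` of `F(t) = e^{-t²}` (GORZ, PNAS 116 (2019),
Thm. 3 / Thm. 6 with `F(t) = e^{-t²}`): `(-1)^{i/2}/(i/2)!` for even `i`, `0` for odd `i`.
[folklore] -/
def expNegSqCoeff (i : ℕ) : ℝ :=
  if Even i then (-1) ^ (i / 2) / ((i / 2)! : ℝ) else 0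

/-- `c₀ = 1`. [folklore] -/
@[simp] lemma expNegSqCoeff_zero : expNegSqCoeff 0 = 1 := by
  simp [expNegSqCoeff]

/-- `c₁ = 0`. [folklore] -/
@[simp] lemma expNegSqCoeff_one : expNegSqCoeff 1 = 0 := by
  simp [expNegSqCoeff]

/-- The odd Taylor coefficients of the even function `e^{-t²}` vanish. [folklore] -/
lemma expNegSqCoeff_of_odd {i : ℕ} (hi : Odd i) : expNegSqCoeff i = 0 := by
  simp [expNegSqCoeff, Nat.not_even_iff_odd.mpr hi]

/-- `c_{2i} = (-1)^i / i!`. [folklore] -/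
lemma expNegSqCoeff_two_mul (i : ℕ) : expNegSqCoeff (2 * i) = (-1) ^ i / (i ! : ℝ) := by
  simp [expNegSqCoeff]

/-- `c_{2i} = (-1)^i / i!` (form `i + i`). [folklore] -/
lemma expNegSqCoeff_two_mul' (i : ℕ) : expNegSqCoeff (i + i) = (-1) ^ i / (i ! : ℝ) := by
  rw [← two_mul]; exact expNegSqCoeff_two_mul i

/-- The recursion `(m + 2) c_{m+2} = -2 c_m` of the Taylor coefficients of `F(t) = e^{-t²}`,
i.e. `F' = -2tF`. [folklore] -/
lemma expNegSqCoeff_add_two (m : ℕ) :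
    ((m : ℝ) + 2) * expNegSqCoeff (m + 2) = -2 * expNegSqCoeff m := by
  unfold expNegSqCoeff
  by_cases hm : Even m
  · have hm2 : Even (m + 2) := hm.add even_two
    rw [if_pos hm2, if_pos hm]
    obtain ⟨i, rfl⟩ := hm
    have h1 : (i + i + 2) / 2 = i + 1 := by omega
    have h2 : (i + i) / 2 = i := by omega
    rw [h1, h2, Nat.factorial_succ, pow_succ]
    push_cast
    field_simp
    ring
  · have hm2 : ¬ Even (m + 2) := fun h => hm ((Nat.even_add.mp h).mpr even_two)
    rw [if_neg hm2, if_neg hm]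
    ring

/-- The generalised Hermite polynomials of GORZ (PNAS 116 (2019), §2, Thm. 6, closed form):
`H_{F,m}(X) := m! ∑_{k=0}^{m} (-1)^{m-k} c_{m-k} X^k / k!` for a coefficient sequence `c` (of a
formal power series `F(t) = ∑ cᵢ tⁱ`); generating function `F(-t) e^{Xt} = ∑ H_{F,m}(X) t^m/m!`. We
take real coefficients (the case needed). [cite: GORZPNAS2019, Thm. 6] -/
def gorzHermiteGen (c : ℕ → ℝ) (m : ℕ) : ℝ[X] :=
  ∑ k ∈ range (m + 1), C ((m ! : ℝ) * (-1) ^ (m - k) * c (m - k) / (k ! : ℝ)) * X ^ k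

/-- `[X^k] H_{F,m} = m! (-1)^{m-k} c_{m-k}/k!` for `k ≤ m`, `0` above. [folklore] -/
lemma coeff_gorzHermiteGen (c : ℕ → ℝ) (m k : ℕ) :
    (gorzHermiteGen c m).coeff k =
      if k ≤ m then (m ! : ℝ) * (-1) ^ (m - k) * c (m - k) / (k ! : ℝ) else 0 := by
  simp only [gorzHermiteGen, finsetSum_coeff, coeff_C_mul_X_pow]
  split_ifs with h
  · rw [Finset.sum_eq_single k]
    · simp
    · intro j _ hj
      simp [Ne.symm hj]
    · intro hk
      simp [mem_range] at hk
      omega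
  · refine Finset.sum_eq_zero fun j hj => ?_
    rw [if_neg]
    rintro rfl
    simp [mem_range] at hj
    omega

/-- `deg H_{F,m} ≤ m`. [folklore] -/
lemma natDegree_gorzHermiteGen_le (c : ℕ → ℝ) (m : ℕ) : (gorzHermiteGen c m).natDegree ≤ m := by
  rw [natDegree_le_iff_coeff_eq_zero]
  intro k hk
  rw [coeff_gorzHermiteGen, if_neg (by exact_mod_cast not_le.mpr hk)]

/-- `H_{F,m}` has leading term `X^m` when `c₀ = 1`. [folklore] -/
lemma coeff_gorzHermiteGen_self (c : ℕ → ℝ) (m : ℕ) (hc : c 0 = 1) :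
    (gorzHermiteGen c m).coeff m = 1 := by
  rw [coeff_gorzHermiteGen, if_pos le_rfl]
  simp [hc, Nat.factorial_ne_zero]

/-- `H_{F,m}` is monic when `c₀ = 1`. [folklore] -/
lemma monic_gorzHermiteGen (c : ℕ → ℝ) (m : ℕ) (hc : c 0 = 1) : (gorzHermiteGen c m).Monic := by
  have hle := natDegree_gorzHermiteGen_le c m
  rcases hle.lt_or_eq with hlt | heq
  · -- impossible: coefficient m is 1
    have := coeff_eq_zero_of_natDegree_lt hlt
    rw [coeff_gorzHermiteGen_self c m hc] at this
    exact absurd this one_ne_zero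
  · rw [Monic, leadingCoeff, heq, coeff_gorzHermiteGen_self c m hc]

/-- `deg H_{F,m} = m` when `c₀ = 1`. [folklore] -/
lemma natDegree_gorzHermiteGen (c : ℕ → ℝ) (m : ℕ) (hc : c 0 = 1) :
    (gorzHermiteGen c m).natDegree = m := by
  refine le_antisymm (natDegree_gorzHermiteGen_le c m) ?_
  exact le_natDegree_of_ne_zero (by rw [coeff_gorzHermiteGen_self c m hc]; exact one_ne_zero)

/-- The Hermite polynomials in the normalisation of GORZ (PNAS 116 (2019), §1, eq. (3)): the
orthogonal polynomials for the weight `e^{-X²/4}`, `∑_d H_d(X) t^d/d! = e^{-t² + Xt}`, so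
`H_0 = 1, H_1 = X, H_2 = X² - 2, H_3 = X³ - 6X`; equivalently `H_d = H_{F,d}` for `F(t) = e^{-t²}`
(Thm. 6). Relation to Mathlib's probabilists' `Polynomial.hermite = He_d`:
`H_d(X) = 2^{d/2} He_d(X/√2)` (`coeff_gorzHermite_eq_coeff_hermite`); we do not reuse
`Polynomial.hermite` because this rescaling is irrational. [cite: GORZPNAS2019, §1 eq. (3)] -/
def gorzHermite (d : ℕ) : ℝ[X] := gorzHermiteGen expNegSqCoeff d

/-- Closed form of the coefficients of `H_d`. [folklore] -/
lemma coeff_gorzHermite (d k : ℕ) :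
    (gorzHermite d).coeff k =
      if k ≤ d then (d ! : ℝ) * (-1) ^ (d - k) * expNegSqCoeff (d - k) / (k ! : ℝ) else 0 :=
  coeff_gorzHermiteGen _ d k

/-- `H_d` is monic. [folklore] -/
lemma monic_gorzHermite (d : ℕ) : (gorzHermite d).Monic :=
  monic_gorzHermiteGen _ d expNegSqCoeff_zero

/-- `deg H_d = d`. [folklore] -/
lemma natDegree_gorzHermite (d : ℕ) : (gorzHermite d).natDegree = d :=
  natDegree_gorzHermiteGen _ d expNegSqCoeff_zero

/-- `H_0 = 1` (GORZ eq. (3)). [cite: GORZPNAS2019, §1 eq. (3)] -/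
@[simp] lemma gorzHermite_zero : gorzHermite 0 = 1 := by
  simp [gorzHermite, gorzHermiteGen]

/-- `H_1 = X` (GORZ eq. (3)). [cite: GORZPNAS2019, §1 eq. (3)] -/
@[simp] lemma gorzHermite_one : gorzHermite 1 = X := by
  simp [gorzHermite, gorzHermiteGen, Finset.sum_range_succ]

/-- The three-term recurrence `H_{d+2} = X H_{d+1} - 2(d+1) H_d` (differentiate the generating
function `e^{-t²+Xt}` in `t`). [folklore] -/
lemma gorzHermite_add_two (d : ℕ) :
    gorzHermite (d + 2) = X * gorzHermite (d + 1) - C (2 * ((d : ℝ) + 1)) * gorzHermite d := by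
  ext k
  rw [coeff_sub, coeff_C_mul]
  rcases k with _ | k
  · rw [mul_comm X, coeff_mul_X_zero, coeff_gorzHermite, coeff_gorzHermite, if_pos (Nat.zero_le _),
      if_pos (Nat.zero_le _)]
    simp only [Nat.sub_zero, Nat.factorial_zero, Nat.cast_one, div_one, zero_sub]
    have h := expNegSqCoeff_add_two d
    rw [Nat.factorial_succ, Nat.factorial_succ]
    push_cast
    have : ((-1 : ℝ)) ^ (d + 2) = (-1) ^ d := by rw [pow_add]; norm_num
    rw [this]
    linear_combination ((d + 1 : ℝ) * (d ! : ℝ) * (-1) ^ d) * h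
  · rw [mul_comm X, coeff_mul_X, coeff_gorzHermite, coeff_gorzHermite, coeff_gorzHermite]
    rcases Nat.lt_or_ge k d with hk | hk
    · -- generic case k + 1 ≤ d
      obtain ⟨m, rfl⟩ := Nat.exists_eq_add_of_lt hk   -- d = k + m + 1
      rw [if_pos (by omega), if_pos (by omega), if_pos (by omega)]
      have e1 : k + m + 1 + 2 - (k + 1) = m + 2 := by omega
      have e2 : k + m + 1 + 1 - k = m + 2 := by omega
      have e3 : k + m + 1 - (k + 1) = m := by omega
      rw [e1, e2, e3]
      have h := expNegSqCoeff_add_two m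
      have : ((-1 : ℝ)) ^ (m + 2) = (-1) ^ m := by rw [pow_add]; norm_num
      rw [this]
      have f1 : ((k + m + 1 + 2)! : ℝ) = (k + m + 3) * (k + m + 2) * ((k + m + 1)! : ℝ) := by
        rw [show k + m + 1 + 2 = (k + m + 2) + 1 by ring, Nat.factorial_succ, Nat.factorial_succ]
        push_cast; ring
      have f2 : ((k + m + 1 + 1)! : ℝ) = (k + m + 2) * ((k + m + 1)! : ℝ) := by
        rw [Nat.factorial_succ]; push_cast; ring
      have f3 : ((k + m + 1)! : ℝ) = (k + m + 1) * ((k + m)! : ℝ) := by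
        rw [Nat.factorial_succ]; push_cast; ring
      have f4 : ((k + 1)! : ℝ) = (k + 1) * (k ! : ℝ) := by
        rw [Nat.factorial_succ]; push_cast; ring
      rw [f1, f2, f3, f4]
      have hk0 : (k ! : ℝ) ≠ 0 := by exact_mod_cast Nat.factorial_ne_zero k
      have hkm0 : ((k + m)! : ℝ) ≠ 0 := by exact_mod_cast Nat.factorial_ne_zero (k + m)
      field_simp
      push_cast
      linear_combination ((k : ℝ) + m + 2) * h
    · rcases hk.lt_or_eq with hk' | hkd
      · -- k > d
        rcases (Nat.succ_le_of_lt hk').lt_or_eq with hk'' | hkd1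
        · rw [if_neg (by omega), if_neg (by omega), if_neg (by omega)]; simp
        · -- k = d + 1
          subst hkd1
          rw [if_pos (by omega), if_pos (by omega), if_neg (by omega)]
          simp [Nat.factorial_ne_zero]
      · -- k = d
        subst hkd
        rw [if_pos (by omega), if_pos (by omega), if_neg (by omega)]
        have e1 : d + 2 - (d + 1) = 1 := by omega
        have e2 : d + 1 - d = 1 := by omega
        simp [e1, e2]


/-- `H_2 = X² - 2` (GORZ eq. (3)). [cite: GORZPNAS2019, §1 eq. (3)] -/
lemma gorzHermite_two : gorzHermite 2 = X ^ 2 - C 2 := by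
  rw [gorzHermite_add_two 0, gorzHermite_one, gorzHermite_zero]; norm_num; ring

/-- `H_3 = X³ - 6X` (GORZ eq. (3)). [cite: GORZPNAS2019, §1 eq. (3)] -/
lemma gorzHermite_three : gorzHermite 3 = X ^ 3 - C 6 * X := by
  rw [gorzHermite_add_two 1, gorzHermite_two, gorzHermite_one]
  simp only [Nat.cast_one]
  have : (C (2 * (1 + 1 : ℝ)) : ℝ[X]) = C 4 := by norm_num
  rw [this]
  have h6 : (C (6 : ℝ) : ℝ[X]) = C 2 + C 4 := by rw [← C_add]; norm_num
  rw [h6]; ring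

/-- Link with Mathlib's probabilists' Hermite polynomials `He_d = Polynomial.hermite d`
(`He_{d+1} = X He_d - He_d'`, generating function `e^{xt - t²/2}`): `H_d(X) = 2^{d/2} He_d(X/√2)`,
coefficientwise `[X^k] H_d = 2^{(d-k)/2} [X^k] He_d` (both vanish unless `d - k` is even).
[folklore] -/
theorem coeff_gorzHermite_eq_coeff_hermite (d k : ℕ) :
    (gorzHermite d).coeff k = 2 ^ ((d - k) / 2) * ((Polynomial.hermite d).coeff k : ℝ) := by
  rcases lt_or_ge d k with hk | hk
  · rw [coeff_eq_zero_of_natDegree_lt ((natDegree_gorzHermite d).trans_lt hk),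
      Polynomial.coeff_hermite_of_lt hk]
    simp
  · rw [coeff_gorzHermite, if_pos hk, Polynomial.coeff_hermite]
    by_cases he : Even (d - k)
    · have he' : Even (d + k) := by
        rcases he with ⟨m, hm⟩; exact ⟨m + k, by omega⟩
      rw [if_pos he']
      obtain ⟨m, hm⟩ := he
      have hd : d = m + m + k := by omega
      rw [hm, show (m + m) / 2 = m by omega, expNegSqCoeff_two_mul' m]
      have hpow : ((-1 : ℝ)) ^ (m + m) = 1 := by rw [← two_mul]; exact (even_two_mul _).neg_one_pow
      rw [hpow, mul_one]
      push_cast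
      have hchoose : (d.choose k : ℝ) * (k ! : ℝ) * ((m + m)! : ℝ) = (d ! : ℝ) := by
        have := Nat.choose_mul_factorial_mul_factorial hk
        rw [hm] at this
        exact_mod_cast this
      have hk0 : (k ! : ℝ) ≠ 0 := by exact_mod_cast Nat.factorial_ne_zero k
      have hm0 : (m ! : ℝ) ≠ 0 := by exact_mod_cast Nat.factorial_ne_zero m
      have hdf : ((m + m)! : ℝ) = 2 ^ m * (m ! : ℝ) * ((m + m - 1)‼ : ℝ) := by
        rcases m with _ | m
        · simp
        · have h1 : (m + 1 + (m + 1))! = (m + 1 + (m + 1))‼ * (m + 1 + (m + 1) - 1)‼ := by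
            rw [show m + 1 + (m + 1) = (2 * m + 1) + 1 by ring,
              Nat.factorial_eq_mul_doubleFactorial]
            simp
          have h2 : (m + 1 + (m + 1))‼ = 2 ^ (m + 1) * (m + 1)! := by
            rw [show m + 1 + (m + 1) = 2 * (m + 1) by ring, Nat.doubleFactorial_two_mul]
          rw [h1, h2]; push_cast; ring
      rw [mul_div_assoc', div_div, div_eq_iff (mul_ne_zero hm0 hk0), ← hchoose, hdf]
      ring
    · have he' : ¬ Even (d + k) := fun h => he (by
        rcases h with ⟨m, hm⟩; exact ⟨m - k, by omega⟩)
      rw [if_neg he', expNegSqCoeff_of_odd (Nat.not_even_iff_odd.mp he)]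
      simp

/-- IVT count: if a real polynomial takes values of opposite signs at consecutive points of a
strictly increasing family `u₀ < ⋯ < u_m`, it has `m` roots strictly interlacing them. [folklore] -/
theorem exists_roots_of_alternating {m : ℕ} (P : ℝ[X]) (u : Fin (m + 1) → ℝ) (hu : StrictMono u)
    (halt : ∀ i : Fin m, P.eval (u i.castSucc) * P.eval (u i.succ) < 0) :
    ∃ t : Fin m → ℝ, StrictMono t ∧ (∀ i, u i.castSucc < t i ∧ t i < u i.succ) ∧
      ∀ i, P.eval (t i) = 0 := by
  have key : ∀ i : Fin m, ∃ x, (u i.castSucc < x ∧ x < u i.succ) ∧ P.eval x = 0 := by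
    intro i
    have hlt : u i.castSucc < u i.succ := hu (Fin.castSucc_lt_succ)
    have hcont : ContinuousOn (fun x => P.eval x) (Set.Icc (u i.castSucc) (u i.succ)) :=
      P.continuous.continuousOn
    rcases mul_neg_iff.mp (halt i) with ⟨h1, h2⟩ | ⟨h1, h2⟩
    · obtain ⟨x, hx, hx0⟩ := intermediate_value_Ioo' hlt.le hcont ⟨h2, h1⟩
      exact ⟨x, hx, hx0⟩
    · obtain ⟨x, hx, hx0⟩ := intermediate_value_Ioo hlt.le hcont ⟨h1, h2⟩
      exact ⟨x, hx, hx0⟩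
  choose t ht ht0 using key
  refine ⟨t, ?_, ht, ht0⟩
  intro i j hij
  calc t i < u i.succ := (ht i).2
    _ ≤ u j.castSucc := hu.monotone (Fin.le_def.mpr (by simp; omega))
    _ < t j := (ht j).1

/-- A nonzero real polynomial of degree `≤ m` with `m` distinct roots splits over `ℝ`, has degree
exactly `m`, and its roots are exactly the given ones. [folklore] -/
theorem splits_of_roots {P : ℝ[X]} (hP : P ≠ 0) {m : ℕ} (hdeg : P.natDegree ≤ m) (t : Fin m → ℝ)
    (ht : Function.Injective t) (hroot : ∀ i, P.eval (t i) = 0) :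
    P.Splits ∧ P.natDegree = m ∧ P.roots = (Finset.univ.val.map t) := by
  set S : Multiset ℝ := Finset.univ.val.map t with hS
  have hSnodup : S.Nodup := Multiset.Nodup.map ht Finset.univ.nodup
  have hScard : S.card = m := by simp [hS]
  have hSle : S ≤ P.roots := by
    rw [Multiset.le_iff_subset hSnodup]
    intro x hx
    obtain ⟨i, _, rfl⟩ := Multiset.mem_map.mp hx
    exact (mem_roots hP).mpr (hroot i)
  have h1 : m ≤ P.roots.card := hScard ▸ Multiset.card_le_card hSle
  have h2 : P.roots.card ≤ P.natDegree := card_roots' P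
  have hcard : P.roots.card = P.natDegree := le_antisymm h2 (hdeg.trans h1)
  refine ⟨splits_iff_card_roots.mpr hcard, by omega, ?_⟩
  exact (Multiset.eq_of_le_of_card_le hSle (by omega)).symm

/-- Sign of `∏ᵢ (t - rᵢ)` when exactly the indices `i ≥ j` have `rᵢ > t`: it is `(-1)^{n-j}`
(written `(-1)^{n+j}`). [folklore] -/
theorem sign_prod_sub {n : ℕ} (r : Fin n → ℝ) (t : ℝ) (j : ℕ) (hj : j ≤ n)
    (hlt : ∀ i : Fin n, (i : ℕ) < j → r i < t) (hgt : ∀ i : Fin n, j ≤ (i : ℕ) → t < r i) :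
    0 < (-1) ^ (n + j) * ∏ i, (t - r i) := by
  induction n with
  | zero =>
    obtain rfl : j = 0 := by omega
    simp
  | succ n ih =>
    rw [Fin.prod_univ_castSucc]
    rcases Nat.lt_or_ge n j with hjn | hjn
    · -- j = n + 1: all factors positive
      obtain rfl : j = n + 1 := by omega
      have hpow : ((-1 : ℝ)) ^ (n + 1 + (n + 1)) = 1 := by
        rw [← two_mul]; exact (even_two_mul _).neg_one_pow
      rw [hpow, one_mul]
      exact mul_pos (Finset.prod_pos fun i _ => sub_pos.mpr (hlt _ (by simp)))
        (sub_pos.mpr (hlt _ (by simp)))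
    · -- j ≤ n: the last factor is negative
      have hlast : t < r (Fin.last n) := hgt _ (by simpa using hjn)
      have ih' := ih (fun i => r i.castSucc) hjn (fun i hi => hlt i.castSucc (by simpa using hi))
        (fun i hi => hgt i.castSucc (by simpa using hi))
      have : ((-1 : ℝ)) ^ (n + 1 + j) * ((∏ i : Fin n, (t - r i.castSucc)) * (t - r (Fin.last n))) =
          ((-1) ^ (n + j) * ∏ i : Fin n, (t - r i.castSucc)) * (r (Fin.last n) - t) := by
        rw [show n + 1 + j = (n + j) + 1 by ring, pow_succ]
        ring
      rw [this]
      exact mul_pos ih' (sub_pos.mpr hlast)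

/-- A strictly increasing family `r₀ < ⋯ < r_{n-1}` leaves room for a point in each of its `n + 1`
gaps. [folklore] -/
theorem exists_between_of_strictMono {n : ℕ} (r : Fin n → ℝ) (hr : StrictMono r) (j : ℕ)
    (hj : j ≤ n) :
    ∃ x : ℝ, (∀ i : Fin n, (i : ℕ) < j → r i < x) ∧ (∀ i : Fin n, j ≤ (i : ℕ) → x < r i) := by
  rcases Nat.eq_zero_or_pos j with rfl | hj0
  · rcases Nat.eq_zero_or_pos n with rfl | hn
    · exact ⟨0, fun i => i.elim0, fun i => i.elim0⟩
    · refine ⟨r ⟨0, hn⟩ - 1, fun i hi => absurd hi (Nat.not_lt_zero _), fun i _ => ?_⟩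
      have : r ⟨0, hn⟩ ≤ r i := hr.monotone (Fin.mk_le_mk.mpr (Nat.zero_le _))
      linarith
  · rcases hj.lt_or_eq with hjn | rfl
    · -- 0 < j < n: midpoint of r (j-1) and r j
      refine ⟨(r ⟨j - 1, by omega⟩ + r ⟨j, hjn⟩) / 2, fun i hi => ?_, fun i hi => ?_⟩
      · have h1 : r i ≤ r ⟨j - 1, by omega⟩ := hr.monotone (Fin.le_def.mpr (by simp; omega))
        have h2 : r ⟨j - 1, by omega⟩ < r ⟨j, hjn⟩ := hr (Fin.mk_lt_mk.mpr (by omega))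
        linarith
      · have h1 : r ⟨j, hjn⟩ ≤ r i := hr.monotone (Fin.le_def.mpr (by simp; omega))
        have h2 : r ⟨j - 1, by omega⟩ < r ⟨j, hjn⟩ := hr (Fin.mk_lt_mk.mpr (by omega))
        linarith
    · -- j = n > 0: above everything
      refine ⟨r ⟨j - 1, by omega⟩ + 1, fun i _ => ?_, fun i hi => absurd hi (by omega)⟩
      have : r i ≤ r ⟨j - 1, by omega⟩ := hr.monotone (Fin.le_def.mpr (by simp; omega))
      linarith

/-- The interlacing invariant of the classical proof that orthogonal polynomials have real simple
zeros (Szegő, *Orthogonal Polynomials*, Thm. 3.3.2): `Q = ∏_{i<n} (X - rᵢ)` with `r₀ < ⋯ < r_{n-1}`,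
and `P` alternates in sign along the `rᵢ`, positive at the top one:
`(-1)^{n-1-i} P(rᵢ) > 0`. [folklore] -/
def Interlaces (n : ℕ) (Q P : ℝ[X]) : Prop :=
  ∃ r : Fin n → ℝ, StrictMono r ∧ Q = ∏ i, (X - C (r i)) ∧
    ∀ i : Fin n, 0 < (-1) ^ (n + 1 + i) * P.eval (r i)

/-- Interlacing step for a three-term recurrence `R = X Q - c P` with `c > 0` and `deg P ≤ n`
(Szegő, *Orthogonal Polynomials*, §3.3): if `(Q, P)` interlace then so do `(R, Q)`; in particular
`R` has `n + 1` simple real zeros separated by those of `Q`. Proof: `R(rᵢ) = -c P(rᵢ)` alternates,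
`R → +∞` at `+∞` and `(-1)^{n+1} R → +∞` at `-∞`, then the intermediate value theorem. [folklore] -/
theorem Interlaces.step {n : ℕ} {Q P : ℝ[X]} (h : Interlaces n Q P) (hn : 1 ≤ n)
    (hP : P.natDegree < n + 1) {c : ℝ} (hc : 0 < c) :
    Interlaces (n + 1) (X * Q - C c * P) Q := by
  obtain ⟨r, hr, hQ, hsign⟩ := h
  set R := X * Q - C c * P with hR
  -- `Q` is monic of degree `n`, `R` monic of degree `n + 1`
  have hQmonic : Q.Monic := by rw [hQ]; exact monic_prod_of_monic _ _ fun i _ => monic_X_sub_C _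
  have hQdeg : Q.natDegree = n := by
    rw [hQ, natDegree_prod_of_monic _ _ fun i _ => monic_X_sub_C _]; simp
  have hXQ : (X * Q).Monic := monic_X.mul hQmonic
  have hXQdeg : (X * Q).natDegree = n + 1 := by
    rw [(monic_X).natDegree_mul hQmonic, hQdeg, natDegree_X, add_comm]
  have hcP : (C c * P).degree < (X * Q).degree := by
    rw [degree_eq_natDegree hXQ.ne_zero, hXQdeg, degree_C_mul hc.ne']
    exact (degree_le_natDegree).trans_lt (by exact_mod_cast hP)
  have hRmonic : R.Monic := hXQ.sub_of_left hcP
  have hRdeg : R.natDegree = n + 1 := by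
    rw [hR, ← hXQdeg]
    exact natDegree_eq_of_degree_eq (degree_sub_eq_left_of_degree_lt hcP)
  have hRne : R ≠ 0 := hRmonic.ne_zero
  -- values of `R` at the old roots
  have hRr : ∀ i : Fin n, R.eval (r i) = -c * P.eval (r i) := by
    intro i
    have hQr : Q.eval (r i) = 0 := by
      rw [hQ, eval_prod]
      exact Finset.prod_eq_zero (Finset.mem_univ i) (by simp)
    simp [hR, hQr]
  -- behaviour at `+∞`
  obtain ⟨shi, hshi_gt, hshi_pos⟩ : ∃ s, r ⟨n - 1, by omega⟩ < s ∧ 0 < R.eval s := by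
    have ht : Tendsto (fun x => R.eval x) atTop atTop :=
      R.tendsto_atTop_of_leadingCoeff_nonneg
        (by rw [degree_eq_natDegree hRne, hRdeg]; exact_mod_cast Nat.succ_pos n)
        (by rw [hRmonic.leadingCoeff]; exact zero_le_one)
    exact ((ht.eventually_gt_atTop 0).and (eventually_gt_atTop _)).exists.imp
      fun s hs => ⟨hs.2, hs.1⟩
  -- behaviour at `-∞`
  obtain ⟨slo, hslo_lt, hslo_pos⟩ : ∃ s, s < r ⟨0, by omega⟩ ∧ 0 < (-1) ^ (n + 1) * R.eval s := by
    set S := C ((-1 : ℝ) ^ (n + 1)) * R.comp (-X) with hS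
    have hSlead : S.leadingCoeff = 1 := by
      rw [hS, leadingCoeff_mul, leadingCoeff_C, comp_neg_X_leadingCoeff_eq, hRdeg,
        hRmonic.leadingCoeff, mul_one, ← pow_add, ← two_mul]
      exact (even_two_mul _).neg_one_pow
    have hSdeg : S.natDegree = n + 1 := by
      rw [hS, natDegree_C_mul (pow_ne_zero _ (by norm_num)), natDegree_comp, hRdeg]; simp
    have hSne : S ≠ 0 := by
      intro h0; rw [h0, leadingCoeff_zero] at hSlead; exact zero_ne_one hSlead
    have ht : Tendsto (fun x => S.eval x) atTop atTop :=
      S.tendsto_atTop_of_leadingCoeff_nonneg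
        (by rw [degree_eq_natDegree hSne, hSdeg]; exact_mod_cast Nat.succ_pos n)
        (by rw [hSlead]; exact zero_le_one)
    obtain ⟨y, hy1, hy2⟩ :=
      ((ht.eventually_gt_atTop 0).and (eventually_gt_atTop (- r ⟨0, by omega⟩))).exists
    refine ⟨-y, by linarith, ?_⟩
    simpa [hS] using hy1
  -- the test points
  let u : Fin (n + 2) → ℝ := fun j =>
    if h0 : (j : ℕ) = 0 then slo else if h1 : (j : ℕ) ≤ n then r ⟨(j : ℕ) - 1, by omega⟩ else shi
  have hu0 : u 0 = slo := by simp [u]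
  have humid : ∀ i : Fin n, u ⟨(i : ℕ) + 1, by omega⟩ = r i := by
    intro i
    simp only [u, Nat.add_one_ne_zero, ↓reduceDIte]
    rw [dif_pos (by omega)]
    congr 1
  have hulast : u (Fin.last (n + 1)) = shi := by
    simp only [u, Fin.val_last]
    rw [dif_neg (by omega), dif_neg (by omega)]
  -- signs of R at the test points
  have hRu : ∀ j : Fin (n + 2), 0 < (-1) ^ (n + 1 + j) * R.eval (u j) := by
    intro j
    by_cases h0 : (j : ℕ) = 0
    · have : j = 0 := Fin.ext h0
      subst this
      simpa [hu0] using hslo_pos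
    · by_cases h1 : (j : ℕ) ≤ n
      · have hj : u j = r ⟨(j : ℕ) - 1, by omega⟩ := by
          have := humid ⟨(j : ℕ) - 1, by omega⟩
          convert this using 2
          ext; simp; omega
        rw [hj, hRr]
        have hs := hsign ⟨(j : ℕ) - 1, by omega⟩
        have hpow : ((-1 : ℝ)) ^ (n + 1 + (j : ℕ)) = (-1) ^ (n + 1 + ((j : ℕ) - 1)) * (-1) := by
          rw [← pow_succ, show n + 1 + ((j : ℕ) - 1) + 1 = n + 1 + (j : ℕ) by omega]
        rw [hpow]
        have : (-1) ^ (n + 1 + ((j : ℕ) - 1)) * -1 * (-c * eval (r ⟨↑j - 1, by omega⟩) P) =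
            c * ((-1) ^ (n + 1 + ((j : ℕ) - 1)) * eval (r ⟨↑j - 1, by omega⟩) P) := by ring
        rw [this]
        exact mul_pos hc (by simpa using hs)
      · have : j = Fin.last (n + 1) := Fin.ext (by simp; omega)
        subst this
        rw [hulast]
        have hpow : ((-1 : ℝ)) ^ (n + 1 + ((Fin.last (n + 1) : Fin (n + 2)) : ℕ)) = 1 := by
          rw [Fin.val_last, ← two_mul]; exact (even_two_mul _).neg_one_pow
        rw [hpow, one_mul]; exact hshi_pos
  -- strict monotonicity of u
  have humono : StrictMono u := by
    rw [Fin.strictMono_iff_lt_succ]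
    intro j
    by_cases h0 : (j : ℕ) = 0
    · have e1 : u j.castSucc = slo := by
        simp only [u]; rw [dif_pos (by simpa using h0)]
      have e2 : u j.succ = r ⟨0, by omega⟩ := by
        simp only [u, Fin.val_succ, Nat.add_one_ne_zero, ↓reduceDIte]
        rw [dif_pos (by omega)]; exact congrArg r (Fin.ext (by simp [h0]))
      rw [e1, e2]; exact hslo_lt
    · by_cases h1 : (j : ℕ) + 1 ≤ n
      · have e1 : u j.castSucc = r ⟨(j : ℕ) - 1, by omega⟩ := by
          simp only [u, Fin.val_castSucc, h0, ↓reduceDIte]; rw [dif_pos (by omega)]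
        have e2 : u j.succ = r ⟨(j : ℕ), by omega⟩ := by
          simp only [u, Fin.val_succ, Nat.add_one_ne_zero, ↓reduceDIte]
          rw [dif_pos (by omega)]; exact congrArg r (Fin.ext (by simp))
        rw [e1, e2]; exact hr (Fin.mk_lt_mk.mpr (by omega))
      · have e1 : u j.castSucc = r ⟨n - 1, by omega⟩ := by
          simp only [u, Fin.val_castSucc, h0, ↓reduceDIte]; rw [dif_pos (by omega)]
          exact congrArg r (Fin.ext (by simp; omega))
        have e2 : u j.succ = shi := by
          simp only [u, Fin.val_succ, Nat.add_one_ne_zero, ↓reduceDIte]; rw [dif_neg (by omega)]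
        rw [e1, e2]; exact hshi_gt
  -- alternation
  have halt : ∀ j : Fin (n + 1), R.eval (u j.castSucc) * R.eval (u j.succ) < 0 := by
    intro j
    have h1 := hRu j.castSucc
    have h2 := hRu j.succ
    have hpow : ((-1 : ℝ)) ^ (n + 1 + (j.succ : ℕ)) = -(-1) ^ (n + 1 + (j.castSucc : ℕ)) := by
      rw [Fin.val_succ, Fin.val_castSucc, ← add_assoc, pow_succ]; ring
    rw [hpow] at h2
    have hsq : ((-1 : ℝ)) ^ (n + 1 + (j.castSucc : ℕ)) * (-1) ^ (n + 1 + (j.castSucc : ℕ)) = 1 := by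
      rw [← pow_add, ← two_mul]; exact (even_two_mul _).neg_one_pow
    nlinarith [mul_pos h1 h2]
  -- the new roots
  obtain ⟨t, htmono, htbetween, htroot⟩ := exists_roots_of_alternating R u humono halt
  obtain ⟨hRsplits, -, hRroots⟩ := splits_of_roots hRne hRdeg.le t htmono.injective htroot
  refine ⟨t, htmono, ?_, ?_⟩
  · -- R = ∏ (X - C tᵢ)
    rw [hRsplits.eq_prod_roots_of_monic hRmonic, hRroots, Multiset.map_map]
    rfl
  · -- signs of Q at the new roots
    intro j
    rw [hQ, eval_prod]
    simp only [eval_sub, eval_X, eval_C]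
    have key := sign_prod_sub r (t j) j (by omega) (fun i hi => ?_) (fun i hi => ?_)
    · convert key using 2
      rw [show n + 1 + 1 + (j : ℕ) = (n + (j : ℕ)) + 2 by ring, pow_add]; norm_num
    · -- r i = u (i+1) ≤ u j.castSucc < t j
      calc r i = u ⟨(i : ℕ) + 1, by omega⟩ := (humid i).symm
        _ ≤ u j.castSucc := humono.monotone (Fin.le_def.mpr (by simp; omega))
        _ < t j := (htbetween j).1
    · calc t j < u j.succ := (htbetween j).2
        _ ≤ u ⟨(i : ℕ) + 1, by omega⟩ := humono.monotone (Fin.le_def.mpr (by simp; omega))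
        _ = r i := humid i

/-! ### Real simple roots of the GORZ Hermite polynomials -/

/-- `H_{n+1}` and `H_n` interlace for every `n` (induction on the recurrence
`gorzHermite_add_two`). [folklore] -/
theorem gorzHermite_interlaces : ∀ n : ℕ, Interlaces (n + 1) (gorzHermite (n + 1)) (gorzHermite n)
  | 0 => by
    refine ⟨fun _ => 0, fun i j h => absurd h (by simp [Fin.lt_def]), ?_, ?_⟩
    · simp
    · intro i
      have : i = 0 := Fin.ext (by omega)
      subst this
      simp
  | n + 1 => by
    have h := (gorzHermite_interlaces n).step (by omega)
      (by rw [natDegree_gorzHermite]; omega) (c := 2 * ((n : ℝ) + 1)) (by positivity)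
    rwa [← gorzHermite_add_two] at h

/-- The Hermite polynomials have only real, simple zeros (Szegő, *Orthogonal Polynomials*,
Thm. 3.3.1; used by GORZ, PNAS 116 (2019), §1, proof of the Corollary: "the Hermite polynomials have
distinct roots"): `H_d = ∏_{i<d} (X - rᵢ)` with `r₀ < r₁ < ⋯ < r_{d-1}`. [folklore] -/
theorem gorzHermite_eq_prod_roots (d : ℕ) :
    ∃ r : Fin d → ℝ, StrictMono r ∧ gorzHermite d = ∏ i, (X - C (r i)) := by
  rcases d with _ | d
  · exact ⟨fun i => i.elim0, fun i => i.elim0, by simp⟩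
  · obtain ⟨r, hr, h, -⟩ := gorzHermite_interlaces d
    exact ⟨r, hr, h⟩

/-- `H_d` is hyperbolic (splits over `ℝ`). [folklore] -/
theorem splits_gorzHermite (d : ℕ) : (gorzHermite d).Splits := by
  obtain ⟨r, -, h⟩ := gorzHermite_eq_prod_roots d
  rw [h]
  exact Splits.prod fun i _ => Splits.X_sub_C _

/-! ### Openness of "`d` simple real roots" under coefficientwise convergence -/

/-- Evaluation at a point is continuous in the coefficients, for polynomials of bounded degree.
[folklore] -/
theorem tendsto_eval_of_tendsto_coeff {ι : Type*} {l : Filter ι} {d : ℕ} {P : ι → ℝ[X]} {H : ℝ[X]}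
    (hdeg : ∀ n, (P n).natDegree ≤ d) (hH : H.natDegree ≤ d)
    (hlim : ∀ k, Tendsto (fun n => (P n).coeff k) l (𝓝 (H.coeff k))) (x : ℝ) :
    Tendsto (fun n => (P n).eval x) l (𝓝 (H.eval x)) := by
  have hP : ∀ n, (P n).eval x = ∑ k ∈ range (d + 1), (P n).coeff k * x ^ k := fun n =>
    eval_eq_sum_range' (Nat.lt_succ_of_le (hdeg n)) x
  have hHx : H.eval x = ∑ k ∈ range (d + 1), H.coeff k * x ^ k :=
    eval_eq_sum_range' (Nat.lt_succ_of_le hH) x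
  simp only [hP, hHx]
  exact tendsto_finsetSum _ fun k _ => (hlim k).mul_const _

/-- Coefficientwise convergence of polynomials of bounded degree implies locally uniform convergence
of the polynomial functions on `ℝ` (uniform convergence on every compact set). [folklore] -/
theorem tendstoLocallyUniformly_eval_of_tendsto_coeff {ι : Type*} {l : Filter ι} {d : ℕ}
    {P : ι → ℝ[X]} {H : ℝ[X]} (hdeg : ∀ n, (P n).natDegree ≤ d) (hH : H.natDegree ≤ d)
    (hlim : ∀ k, Tendsto (fun n => (P n).coeff k) l (𝓝 (H.coeff k))) :
    TendstoLocallyUniformly (fun n x => (P n).eval x) (fun x => H.eval x) l := by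
  rw [tendstoLocallyUniformly_iff_forall_isCompact]
  intro K hK
  obtain ⟨R, hR⟩ := (Metric.isBounded_iff_subset_closedBall 0).mp hK.isBounded
  rw [Metric.tendstoUniformlyOn_iff]
  intro ε hε
  have hsum : Tendsto (fun n => ∑ k ∈ range (d + 1), |(P n).coeff k - H.coeff k| * |R| ^ k) l
      (𝓝 (∑ k ∈ range (d + 1), |H.coeff k - H.coeff k| * |R| ^ k)) :=
    tendsto_finsetSum _ fun k _ => (((hlim k).sub_const _).abs).mul_const _
  simp only [sub_self, abs_zero, zero_mul, Finset.sum_const_zero] at hsum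
  filter_upwards [hsum.eventually_lt_const hε] with n hn x hx
  have hxR : |x| ≤ |R| := by
    have : dist x 0 ≤ R := hR hx
    rw [Real.dist_eq, sub_zero] at this
    exact this.trans (le_abs_self R)
  rw [Real.dist_eq, eval_eq_sum_range' (Nat.lt_succ_of_le hH),
    eval_eq_sum_range' (Nat.lt_succ_of_le (hdeg n)), ← Finset.sum_sub_distrib]
  refine lt_of_le_of_lt ?_ hn
  refine (Finset.abs_sum_le_sum_abs _ _).trans (Finset.sum_le_sum fun k _ => ?_)
  rw [← sub_mul, abs_mul, abs_pow, abs_sub_comm]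
  exact mul_le_mul_of_nonneg_left (pow_le_pow_left₀ (abs_nonneg x) hxR k) (abs_nonneg _)


/-- Openness of "`d` simple real roots" (the deformation argument of GORZ, PNAS 116 (2019), §1,
proof of the Corollary): if real polynomials `Pₙ` of degree `≤ d` converge coefficientwise (along
any filter) to `a ∏_{i<d} (X - rᵢ)` with `a ≠ 0` and `r₀ < ⋯ < r_{d-1}`, then eventually `Pₙ` splits
over `ℝ` with degree exactly `d`. Proof: sign alternation of the limit at points in the `d + 1` gaps
persists, then `exists_roots_of_alternating`. [folklore] -/
theorem eventually_splits_of_tendsto_coeff {ι : Type*} {l : Filter ι} {d : ℕ} {r : Fin d → ℝ}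
    (hr : StrictMono r) {a : ℝ} (ha : a ≠ 0) {P : ι → ℝ[X]} (hdeg : ∀ n, (P n).natDegree ≤ d)
    (hlim : ∀ k, Tendsto (fun n => (P n).coeff k) l (𝓝 ((C a * ∏ i, (X - C (r i))).coeff k))) :
    ∀ᶠ n in l, (P n).Splits ∧ (P n).natDegree = d := by
  set H : ℝ[X] := C a * ∏ i, (X - C (r i)) with hH
  have hHdeg : H.natDegree ≤ d := by
    rw [hH, natDegree_C_mul ha, natDegree_prod_of_monic _ _ fun i _ => monic_X_sub_C _]
    simp
  have hHeval : ∀ x, H.eval x = a * ∏ i, (x - r i) := by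
    intro x; simp [hH, eval_prod]
  -- test points in the gaps
  have hex : ∀ j : Fin (d + 1), ∃ x : ℝ, (∀ i : Fin d, (i : ℕ) < j → r i < x) ∧
      (∀ i : Fin d, (j : ℕ) ≤ i → x < r i) := fun j =>
    exists_between_of_strictMono r hr j (by omega)
  choose u hu_lt hu_gt using hex
  have hsign : ∀ j : Fin (d + 1), 0 < (-1) ^ (d + j) * ∏ i, (u j - r i) := fun j =>
    sign_prod_sub r (u j) j (by omega) (hu_lt j) (hu_gt j)
  have humono : StrictMono u := by
    rw [Fin.strictMono_iff_lt_succ]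
    intro j
    calc u j.castSucc < r ⟨j, j.isLt⟩ := hu_gt j.castSucc ⟨j, j.isLt⟩ (by simp)
      _ < u j.succ := hu_lt j.succ ⟨j, j.isLt⟩ (by simp)
  have hHne : ∀ j, H.eval (u j) ≠ 0 := by
    intro j
    rw [hHeval]
    refine mul_ne_zero ha fun h0 => ?_
    have := hsign j
    rw [h0, mul_zero] at this
    exact lt_irrefl _ this
  -- eventually the values of `P n` at the test points have the signs of `H`
  have hev : ∀ᶠ n in l, ∀ j : Fin (d + 1), 0 < H.eval (u j) * (P n).eval (u j) := by
    rw [eventually_all]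
    intro j
    have ht : Tendsto (fun n => H.eval (u j) * (P n).eval (u j)) l
        (𝓝 (H.eval (u j) * H.eval (u j))) :=
      (tendsto_eval_of_tendsto_coeff hdeg hHdeg hlim (u j)).const_mul _
    exact ht.eventually_const_lt (mul_self_pos.mpr (hHne j))
  filter_upwards [hev] with n hn
  have hPne : P n ≠ 0 := by
    intro h0
    have := hn 0
    rw [h0, eval_zero, mul_zero] at this
    exact lt_irrefl _ this
  have halt : ∀ j : Fin d, (P n).eval (u j.castSucc) * (P n).eval (u j.succ) < 0 := by
    intro j
    have h1 := hn j.castSucc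
    have h2 := hn j.succ
    have s1 := hsign j.castSucc
    have s2 := hsign j.succ
    -- H(u_j) H(u_{j+1}) < 0
    have hpow : ((-1 : ℝ)) ^ (d + (j.succ : ℕ)) = -(-1) ^ (d + (j.castSucc : ℕ)) := by
      rw [Fin.val_succ, Fin.val_castSucc, ← add_assoc, pow_succ]; ring
    rw [hpow] at s2
    have hsq : ((-1 : ℝ)) ^ (d + (j.castSucc : ℕ)) * (-1) ^ (d + (j.castSucc : ℕ)) = 1 := by
      rw [← pow_add, ← two_mul]; exact (even_two_mul _).neg_one_pow
    have hHH : H.eval (u j.castSucc) * H.eval (u j.succ) < 0 := by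
      rw [hHeval, hHeval]
      have ha2 : 0 < a * a := mul_self_pos.mpr ha
      nlinarith [mul_pos s1 s2]
    nlinarith [mul_pos h1 h2]
  obtain ⟨t, htmono, -, htroot⟩ := exists_roots_of_alternating (P n) u humono halt
  obtain ⟨hs, hd, -⟩ := splits_of_roots hPne (hdeg n) t htmono.injective htroot
  exact ⟨hs, hd⟩


/-! ### The renormalised Jensen polynomials and GORZ's Theorem 6 -/

/-- GORZ's renormalised Jensen polynomial (PNAS 116 (2019), Thm. 3, eq. (5), with `exp(A(n))`
replaced by a general `E(n)` as in Thm. 6): `δ(n)^{-d}/α(n) · J^{d,n}_α((δ(n) X - 1)/E(n))`, i.e.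
`C (δ(n)^{-d}/α(n)) · (J^{d,n}_α ∘ ((δ(n)/E(n)) X - E(n)⁻¹))`. Junk values (`δ(n) = 0`, `E(n) = 0`,
`α(n) = 0`) follow Lean's `x/0 = 0`; only large `n` matter. [cite: GORZPNAS2019, Thm. 3 eq. (5)] -/
def jensenPolyRescaled (α E δ : ℕ → ℝ) (d n : ℕ) : ℝ[X] :=
  C ((δ n)⁻¹ ^ d / α n) * (jensenPoly α d n).comp (C (δ n / E n) * X - C (E n)⁻¹)

/-- Binomial expansion: `[X^k] (aX - b)^j = (j choose k) a^k (-b)^{j-k}`. [folklore] -/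
lemma coeff_C_mul_X_sub_C_pow (a b : ℝ) (j k : ℕ) :
    ((C a * X - C b) ^ j).coeff k = (j.choose k : ℝ) * a ^ k * (-b) ^ (j - k) := by
  rw [sub_eq_add_neg, ← C_neg, add_pow, finsetSum_coeff]
  have hterm : ∀ m ∈ range (j + 1),
      ((C a * X) ^ m * C (-b) ^ (j - m) * (j.choose m : ℝ[X])).coeff k =
        if k = m then (j.choose k : ℝ) * a ^ k * (-b) ^ (j - k) else 0 := by
    intro m _
    rw [mul_pow, ← C_pow, ← C_pow, ← C_eq_natCast, coeff_mul_C, coeff_mul_C, coeff_C_mul,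
      coeff_X_pow]
    split_ifs with h
    · subst h; ring
    · ring
  rw [Finset.sum_congr rfl hterm, Finset.sum_ite_eq]
  split_ifs with h
  · rfl
  · rw [Nat.choose_eq_zero_of_lt (by simpa using h)]
    simp

/-- `deg J^{d,n}_γ ≤ d`. [folklore] -/
lemma natDegree_jensenPoly_le (γ : ℕ → ℝ) (d n : ℕ) : (jensenPoly γ d n).natDegree ≤ d := by
  unfold jensenPoly
  refine (natDegree_sum_le_of_forall_le _ _ fun j hj => ?_)
  refine (natDegree_C_mul_X_pow_le _ _).trans ?_
  simpa [Nat.lt_succ_iff] using hj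

/-- The renormalised Jensen polynomial still has degree `≤ d`. [folklore] -/
lemma natDegree_jensenPolyRescaled_le (α E δ : ℕ → ℝ) (d n : ℕ) :
    (jensenPolyRescaled α E δ d n).natDegree ≤ d := by
  unfold jensenPolyRescaled
  refine (natDegree_C_mul_le _ _).trans ?_
  refine natDegree_comp_le.trans ?_
  calc (jensenPoly α d n).natDegree * (C (δ n / E n) * X - C (E n)⁻¹).natDegree
      ≤ d * 1 := Nat.mul_le_mul (natDegree_jensenPoly_le α d n) (by
        rw [sub_eq_add_neg, ← C_neg]; exact natDegree_linear_le)
    _ = d := mul_one d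

/-- Raw coefficient formula for the renormalised Jensen polynomial (expand `((δ/E) X - E⁻¹)^j`).
[folklore] -/
lemma coeff_jensenPolyRescaled (α E δ : ℕ → ℝ) (d n k : ℕ) :
    (jensenPolyRescaled α E δ d n).coeff k =
      (δ n)⁻¹ ^ d / α n * ∑ j ∈ range (d + 1),
        (d.choose j : ℝ) * α (n + j) *
          ((j.choose k : ℝ) * (δ n / E n) ^ k * (-(E n)⁻¹) ^ (j - k)) := by
  unfold jensenPolyRescaled jensenPoly
  rw [coeff_C_mul, Polynomial.sum_comp, finsetSum_coeff]
  congr 1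
  refine Finset.sum_congr rfl fun j _ => ?_
  rw [mul_comp, C_comp, X_pow_comp, coeff_C_mul, coeff_C_mul_X_sub_C_pow]

/-- The coefficient formula of GORZ, PNAS 116 (2019), §2 (first display of the proof of Thm. 6):
`[X^k] (δ^{-d}/α(n)) J^{d,n}_α((δX-1)/E)
  = δ^{k-d} ∑_j (d choose j)(j choose k)(-1)^{j-k} α(n+j)/(α(n) E^j)`
(they write `(d choose k)(d-k choose j-k)` for `(d choose j)(j choose k)`), valid for `k ≤ d`,
`δ(n) ≠ 0`. [cite: GORZPNAS2019, §2] -/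
lemma coeff_jensenPolyRescaled_of_ne_zero {α E δ : ℕ → ℝ} {d n k : ℕ} (hk : k ≤ d)
    (hδ : δ n ≠ 0) :
    (jensenPolyRescaled α E δ d n).coeff k =
      (δ n)⁻¹ ^ (d - k) * ∑ j ∈ range (d + 1),
        (d.choose j : ℝ) * (j.choose k : ℝ) * (-1) ^ (j - k) * (α (n + j) / α n * (E n)⁻¹ ^ j) := by
  have hsplit : (δ n)⁻¹ ^ d = (δ n)⁻¹ ^ (d - k) * (δ n)⁻¹ ^ k := by
    rw [← pow_add, Nat.sub_add_cancel hk]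
  rw [coeff_jensenPolyRescaled, hsplit, Finset.mul_sum, Finset.mul_sum]
  refine Finset.sum_congr rfl fun j _ => ?_
  rcases lt_or_ge j k with hjk | hjk
  · rw [Nat.choose_eq_zero_of_lt hjk]; simp
  · have hE : (δ n / E n) ^ k * (-(E n)⁻¹) ^ (j - k) = δ n ^ k * (-1) ^ (j - k) * (E n)⁻¹ ^ j := by
      rw [div_eq_mul_inv, mul_pow, neg_eq_neg_one_mul, mul_pow]
      rw [show (E n)⁻¹ ^ j = (E n)⁻¹ ^ k * (E n)⁻¹ ^ (j - k) by
        rw [← pow_add, Nat.add_sub_cancel' hjk]]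
      ring
    have hδk : (δ n)⁻¹ ^ k * δ n ^ k = 1 := by rw [← mul_pow, inv_mul_cancel₀ hδ, one_pow]
    linear_combination ((δ n)⁻¹ ^ (d - k) * (δ n)⁻¹ ^ k / α n * (d.choose j : ℝ) * α (n + j) *
      (j.choose k : ℝ)) * hE + ((δ n)⁻¹ ^ (d - k) / α n * (d.choose j : ℝ) * α (n + j) *
      (j.choose k : ℝ) * (-1) ^ (j - k) * (E n)⁻¹ ^ j) * hδk

/-- The inner sum of GORZ §2 is an iterated forward difference:
`∑_{m ≤ N} (N choose m) (-1)^m f(k + m) = (-1)^N Δ^N f (k)` for `f = x ↦ xⁱ`. [folklore] -/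
lemma sum_choose_mul_neg_one_pow_mul_eq_fwdDiff (N i : ℕ) (k : ℝ) :
    ∑ m ∈ range (N + 1), (N.choose m : ℝ) * (-1) ^ m * (k + m) ^ i =
      (-1) ^ N * (Δ_[1]^[N] (fun x : ℝ => x ^ i)) k := by
  rw [fwdDiff_iter_eq_sum_shift, Finset.mul_sum]
  refine Finset.sum_congr rfl fun m hm => ?_
  have hmN : m ≤ N := Nat.lt_succ_iff.mp (mem_range.mp hm)
  rw [zsmul_eq_mul]
  push_cast
  rw [nsmul_eq_mul, mul_one]
  have : ((-1 : ℝ)) ^ N = (-1) ^ (N - m) * (-1) ^ m := by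
    rw [← pow_add, Nat.sub_add_cancel hmN]
  rw [this]
  have h2 : ((-1 : ℝ)) ^ (N - m) * (-1) ^ (N - m) = 1 := by
    rw [← pow_add, ← two_mul]; exact (even_two_mul _).neg_one_pow
  linear_combination (-((N.choose m : ℝ) * (-1) ^ m * (k + m) ^ i)) * h2

/-- `∑_{m ≤ N} (N choose m)(-1)^m (k+m)ⁱ = 0` for `i < N` (the `N`-th difference of a polynomial of
degree `< N` vanishes; GORZ §2, "vanishes for `i < d - k`"). [folklore] -/
lemma sum_choose_mul_neg_one_pow_mul_pow_of_lt {N i : ℕ} (h : i < N) (k : ℝ) :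
    ∑ m ∈ range (N + 1), (N.choose m : ℝ) * (-1) ^ m * (k + m) ^ i = 0 := by
  rw [sum_choose_mul_neg_one_pow_mul_eq_fwdDiff, fwdDiff_iter_pow_eq_zero_of_lt h]
  simp

/-- `∑_{m ≤ N} (N choose m)(-1)^m (k+m)^N = (-1)^N N!` (the `N`-th difference of `x^N` is `N!`;
GORZ §2, "equals `(d-k)!` for `i = d - k`"). [folklore] -/
lemma sum_choose_mul_neg_one_pow_mul_pow_self (N : ℕ) (k : ℝ) :
    ∑ m ∈ range (N + 1), (N.choose m : ℝ) * (-1) ^ m * (k + m) ^ N = (-1) ^ N * N ! := by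
  rw [sum_choose_mul_neg_one_pow_mul_eq_fwdDiff, fwdDiff_iter_eq_factorial]
  rfl

/-- Reindexing `j = k + m` with `(d choose j)(j choose k) = (d choose k)(d-k choose m)`.
[folklore] -/
lemma sum_choose_choose_reindex (d k : ℕ) (hk : k ≤ d) (f : ℕ → ℝ) :
    ∑ j ∈ range (d + 1), (d.choose j : ℝ) * (j.choose k : ℝ) * (-1) ^ (j - k) * f j =
      (d.choose k : ℝ) *
        ∑ m ∈ range (d - k + 1), ((d - k).choose m : ℝ) * (-1) ^ m * f (k + m) := by
  rw [← sum_range_add_sum_Ico _ (show k ≤ d + 1 by omega)]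
  rw [Finset.sum_eq_zero (fun j hj => by
    rw [Nat.choose_eq_zero_of_lt (k := k) (mem_range.mp hj)]; simp), zero_add,
    sum_Ico_eq_sum_range, show d + 1 - k = d - k + 1 by omega, Finset.mul_sum]
  refine Finset.sum_congr rfl fun m hm => ?_
  have hm' : k + m ≤ d := by have := mem_range.mp hm; omega
  have hchoose : (d.choose (k + m) : ℝ) * ((k + m).choose k : ℝ) =
      (d.choose k : ℝ) * ((d - k).choose m : ℝ) := by
    have := Nat.choose_mul (n := d) (k := k + m) (s := k) (Nat.le_add_right k m)
    rw [Nat.add_sub_cancel_left] at this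
    exact_mod_cast this
  rw [Nat.add_sub_cancel_left]
  linear_combination ((-1 : ℝ) ^ m * f (k + m)) * hchoose

/-- Rearranging a double sum (bookkeeping for the proof of Thm. 6). [folklore] -/
lemma mul_sum_mul_sum_add_rearrange (x : ℝ) (w e a : ℕ → ℝ) (s t : Finset ℕ) (p : ℕ → ℕ → ℝ) :
    x * ∑ j ∈ s, w j * (∑ i ∈ t, a i * p i j + e j) =
      ∑ i ∈ t, a i * x * ∑ j ∈ s, w j * p i j + x * ∑ j ∈ s, w j * e j := by
  simp only [mul_add, Finset.sum_add_distrib, Finset.mul_sum]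
  congr 1
  rw [Finset.sum_comm]
  exact Finset.sum_congr rfl fun i _ => Finset.sum_congr rfl fun j _ => by ring

/-- The value `(d choose k)(-1)^{d-k}(d-k)!` of GORZ's inner sum at `i = d - k`. [folklore] -/
lemma sum_choose_choose_neg_one_pow_mul_pow_self (d k : ℕ) (hk : k ≤ d) :
    ∑ j ∈ range (d + 1), (d.choose j : ℝ) * (j.choose k : ℝ) * (-1) ^ (j - k) * (j : ℝ) ^ (d - k) =
      (d.choose k : ℝ) * ((-1) ^ (d - k) * (d - k)!) := by
  rw [sum_choose_choose_reindex d k hk (fun j => (j : ℝ) ^ (d - k))]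
  congr 1
  push_cast
  exact sum_choose_mul_neg_one_pow_mul_pow_self (d - k) k

/-- GORZ's inner sum vanishes for `i < d - k`. [folklore] -/
lemma sum_choose_choose_neg_one_pow_mul_pow_of_lt (d k i : ℕ) (hk : k ≤ d) (hi : i < d - k) :
    ∑ j ∈ range (d + 1), (d.choose j : ℝ) * (j.choose k : ℝ) * (-1) ^ (j - k) * (j : ℝ) ^ i =
      0 := by
  rw [sum_choose_choose_reindex d k hk (fun j => (j : ℝ) ^ i)]
  push_cast
  rw [sum_choose_mul_neg_one_pow_mul_pow_of_lt hi, mul_zero]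

/-- **GORZ, Theorem 6** (PNAS 116 (2019), §2, Thm. 6), coefficientwise form. Let `δ(n) → 0`
(`δ(n) ≠ 0` for large `n`), `Cᵢ(n) → cᵢ` (`0 ≤ i ≤ d`) and suppose that for `0 ≤ j ≤ d`
`α(n+j)/α(n) · E(n)^{-j} = ∑_{i=0}^{d} Cᵢ(n) δ(n)^i j^i + o(δ(n)^d)`. Then every coefficient of
`δ(n)^{-d}/α(n) · J^{d,n}_α((δ(n) X - 1)/E(n))` tends to the corresponding coefficient of
`H_{F,d}(X) = d! ∑_k (-1)^{d-k} c_{d-k} X^k/k!`. (The printed statement takes `E, δ` positive and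
`cᵢ ∈ ℂ` and concludes locally uniform convergence in `X`; for polynomials of degree `≤ d`
coefficientwise convergence is the same thing, cf. `tendsto_eval_of_tendsto_coeff`; we treat real
`cᵢ`.) Proof as printed: the coefficient formula `coeff_jensenPolyRescaled_of_ne_zero` and the
forward differences `Δ^{d-k} x^i (k)`. [cite: GORZPNAS2019, Thm. 6] -/
theorem tendsto_coeff_jensenPolyRescaled {α E δ : ℕ → ℝ} {d : ℕ} {Cn : ℕ → ℕ → ℝ} {c : ℕ → ℝ}
    (hδ0 : ∀ᶠ n in atTop, δ n ≠ 0) (hδ : Tendsto δ atTop (𝓝 0))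
    (hC : ∀ i ≤ d, Tendsto (Cn i) atTop (𝓝 (c i)))
    (hρ : ∀ j ≤ d, (fun n => α (n + j) / α n * (E n)⁻¹ ^ j -
        ∑ i ∈ range (d + 1), Cn i n * δ n ^ i * (j : ℝ) ^ i) =o[atTop] fun n => δ n ^ d)
    (k : ℕ) :
    Tendsto (fun n => (jensenPolyRescaled α E δ d n).coeff k) atTop
      (𝓝 ((gorzHermiteGen c d).coeff k)) := by
  rcases lt_or_ge d k with hk | hk
  · -- both sides vanish above degree `d`
    have h1 : ∀ n, (jensenPolyRescaled α E δ d n).coeff k = 0 := fun n =>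
      coeff_eq_zero_of_natDegree_lt ((natDegree_jensenPolyRescaled_le α E δ d n).trans_lt hk)
    have h2 : (gorzHermiteGen c d).coeff k = 0 :=
      coeff_eq_zero_of_natDegree_lt ((natDegree_gorzHermiteGen_le c d).trans_lt hk)
    simp only [h1, h2]
    exact tendsto_const_nhds
  · -- the error terms `ε n j`
    obtain ⟨ε, hε⟩ : ∃ ε : ℕ → ℕ → ℝ, ∀ n j, ε n j = α (n + j) / α n * (E n)⁻¹ ^ j -
        ∑ i ∈ range (d + 1), Cn i n * δ n ^ i * (j : ℝ) ^ i := ⟨_, fun _ _ => rfl⟩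
    have hεlim : ∀ j ≤ d, Tendsto (fun n => ε n j / δ n ^ d) atTop (𝓝 0) := fun j hj => by
      simpa only [hε] using (hρ j hj).tendsto_div_nhds_zero
    -- the weights `w j` and inner sums `S i`
    obtain ⟨w, hw⟩ : ∃ w : ℕ → ℝ, ∀ j, w j = (d.choose j : ℝ) * (j.choose k : ℝ) * (-1) ^ (j - k) :=
      ⟨_, fun _ => rfl⟩
    obtain ⟨S, hS⟩ : ∃ S : ℕ → ℝ, ∀ i, S i = ∑ j ∈ range (d + 1), w j * (j : ℝ) ^ i :=
      ⟨_, fun _ => rfl⟩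
    have hS_lt : ∀ i, i < d - k → S i = 0 := fun i hi => by
      rw [hS]; simp only [hw]; exact sum_choose_choose_neg_one_pow_mul_pow_of_lt d k i hk hi
    have hS_eq : S (d - k) = (d.choose k : ℝ) * ((-1) ^ (d - k) * (d - k)!) := by
      rw [hS]; simp only [hw]; exact sum_choose_choose_neg_one_pow_mul_pow_self d k hk
    -- eventual formula for the coefficient
    have hformula : ∀ᶠ n in atTop, (jensenPolyRescaled α E δ d n).coeff k =
        ∑ i ∈ range (d + 1), Cn i n * δ n ^ i * (δ n)⁻¹ ^ (d - k) * S i +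
          (δ n)⁻¹ ^ (d - k) * ∑ j ∈ range (d + 1), w j * ε n j := by
      filter_upwards [hδ0] with n hn
      rw [coeff_jensenPolyRescaled_of_ne_zero hk hn]
      have hρj : ∀ j, α (n + j) / α n * (E n)⁻¹ ^ j =
          ∑ i ∈ range (d + 1), (Cn i n * δ n ^ i) * (j : ℝ) ^ i + ε n j := fun j => by
        rw [hε]; ring
      simp only [hρj, ← hw, hS]
      exact mul_sum_mul_sum_add_rearrange _ w (ε n) (fun i => Cn i n * δ n ^ i) _ _
        (fun i j => (j : ℝ) ^ i)
    -- limits of the individual terms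
    have hmain : ∀ i ∈ range (d + 1), Tendsto (fun n => Cn i n * δ n ^ i * (δ n)⁻¹ ^ (d - k) * S i)
        atTop (𝓝 (if i = d - k then c (d - k) * S (d - k) else 0)) := by
      intro i hi
      have hid : i ≤ d := Nat.lt_succ_iff.mp (mem_range.mp hi)
      rcases lt_trichotomy i (d - k) with hlt | heq | hgt
      · rw [if_neg hlt.ne, hS_lt i hlt]
        simp only [mul_zero]
        exact tendsto_const_nhds
      · subst heq
        rw [if_pos rfl]
        have hev : (fun n => Cn (d - k) n * S (d - k)) =ᶠ[atTop]
            fun n => Cn (d - k) n * δ n ^ (d - k) * (δ n)⁻¹ ^ (d - k) * S (d - k) := by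
          filter_upwards [hδ0] with n hn
          rw [mul_assoc (Cn (d - k) n), ← mul_pow, mul_inv_cancel₀ hn, one_pow, mul_one]
        exact Tendsto.congr' hev (((hC _ hid).mul_const _))
      · rw [if_neg hgt.ne']
        obtain ⟨m, hm⟩ : ∃ m, i = d - k + (m + 1) := ⟨i - (d - k) - 1, by omega⟩
        have hpow : ∀ n, δ n ≠ 0 → δ n ^ i * (δ n)⁻¹ ^ (d - k) = δ n ^ (m + 1) := fun n hn => by
          rw [hm, pow_add, mul_assoc, mul_comm (δ n ^ (m + 1)), ← mul_assoc, ← mul_pow,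
            mul_inv_cancel₀ hn, one_pow, one_mul]
        have hev : (fun n => Cn i n * δ n ^ (m + 1) * S i) =ᶠ[atTop]
            fun n => Cn i n * δ n ^ i * (δ n)⁻¹ ^ (d - k) * S i := by
          filter_upwards [hδ0] with n hn
          rw [mul_assoc (Cn i n) (δ n ^ i), hpow n hn]
        refine Tendsto.congr' hev ?_
        have h0 : Tendsto (fun n => δ n ^ (m + 1)) atTop (𝓝 0) := by
          simpa [zero_pow (Nat.succ_ne_zero m)] using hδ.pow (m + 1)
        simpa using ((hC i hid).mul h0).mul_const (S i)
    have herr : Tendsto (fun n => (δ n)⁻¹ ^ (d - k) * ∑ j ∈ range (d + 1), w j * ε n j)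
        atTop (𝓝 0) := by
      have hev : (fun n => ∑ j ∈ range (d + 1), w j * (ε n j / δ n ^ d * δ n ^ k)) =ᶠ[atTop]
          fun n => (δ n)⁻¹ ^ (d - k) * ∑ j ∈ range (d + 1), w j * ε n j := by
        filter_upwards [hδ0] with n hn
        rw [Finset.mul_sum]
        refine Finset.sum_congr rfl fun j _ => ?_
        have hd : δ n ^ d = δ n ^ (d - k) * δ n ^ k := by rw [← pow_add, Nat.sub_add_cancel hk]
        have : (δ n)⁻¹ ^ (d - k) = δ n ^ k / δ n ^ d := by
          rw [eq_div_iff (pow_ne_zero _ hn), hd, ← mul_assoc, ← mul_pow, inv_mul_cancel₀ hn,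
            one_pow, one_mul]
        rw [this]; ring
      refine Tendsto.congr' hev ?_
      have : Tendsto (fun n => ∑ j ∈ range (d + 1), w j * (ε n j / δ n ^ d * δ n ^ k)) atTop
          (𝓝 (∑ j ∈ range (d + 1), w j * (0 * 0 ^ k))) :=
        tendsto_finsetSum _ fun j hj =>
          ((hεlim j (Nat.lt_succ_iff.mp (mem_range.mp hj))).mul (hδ.pow k)).const_mul _
      simpa using this
    -- assemble
    have hlim := (tendsto_finsetSum _ hmain).add herr
    rw [Finset.sum_ite_eq' (range (d + 1)) (d - k) (fun _ => c (d - k) * S (d - k)),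
      if_pos (Finset.mem_range.mpr (by omega)), add_zero] at hlim
    have hval : c (d - k) * S (d - k) = (gorzHermiteGen c d).coeff k := by
      rw [hS_eq, coeff_gorzHermiteGen, if_pos hk]
      have hfac : (d.choose k : ℝ) * (k ! : ℝ) * ((d - k)! : ℝ) = (d ! : ℝ) := by
        exact_mod_cast Nat.choose_mul_factorial_mul_factorial hk
      have hk0 : (k ! : ℝ) ≠ 0 := by exact_mod_cast Nat.factorial_ne_zero k
      rw [eq_div_iff hk0]
      linear_combination ((-1 : ℝ) ^ (d - k) * c (d - k)) * hfac
    rw [hval] at hlim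
    exact hlim.congr' (Filter.EventuallyEq.symm hformula)


/-! ### Coefficientwise convergence of sequences of polynomials -/

/-- Coefficientwise convergence `Pₙ → Q` of a sequence of real polynomials. [folklore] -/
def CoeffTendsto (P : ℕ → ℝ[X]) (Q : ℝ[X]) : Prop :=
  ∀ i, Tendsto (fun n => (P n).coeff i) atTop (𝓝 (Q.coeff i))

/-- A constant sequence converges coefficientwise. [folklore] -/
lemma CoeffTendsto.const (Q : ℝ[X]) : CoeffTendsto (fun _ => Q) Q := fun _ => tendsto_const_nhds

/-- `C bₙ → C b` coefficientwise when `bₙ → b`. [folklore] -/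
lemma CoeffTendsto.of_C {b : ℕ → ℝ} {b₀ : ℝ} (hb : Tendsto b atTop (𝓝 b₀)) :
    CoeffTendsto (fun n => C (b n)) (C b₀) := by
  intro i
  rcases i with _ | i
  · simpa using hb
  · simp

/-- Coefficientwise convergence is preserved by sums. [folklore] -/
lemma CoeffTendsto.add {P P' : ℕ → ℝ[X]} {Q Q' : ℝ[X]} (h : CoeffTendsto P Q)
    (h' : CoeffTendsto P' Q') :
    CoeffTendsto (fun n => P n + P' n) (Q + Q') := fun i => by
  simpa [coeff_add] using (h i).add (h' i)

/-- Coefficientwise convergence is preserved by products (Cauchy product formula). [folklore] -/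
lemma CoeffTendsto.mul {P P' : ℕ → ℝ[X]} {Q Q' : ℝ[X]} (h : CoeffTendsto P Q)
    (h' : CoeffTendsto P' Q') :
    CoeffTendsto (fun n => P n * P' n) (Q * Q') := fun i => by
  simp only [coeff_mul]
  exact tendsto_finsetSum _ fun x _ => (h x.1).mul (h' x.2)

/-- Coefficientwise convergence is preserved by powers. [folklore] -/
lemma CoeffTendsto.pow {P : ℕ → ℝ[X]} {Q : ℝ[X]} (h : CoeffTendsto P Q) (m : ℕ) :
    CoeffTendsto (fun n => P n ^ m) (Q ^ m) := by
  induction m with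
  | zero => simpa using CoeffTendsto.const 1
  | succ m ih => simpa [pow_succ] using ih.mul h

/-- Coefficientwise convergence is preserved by finite sums. [folklore] -/
lemma CoeffTendsto.sum {ι : Type*} (s : Finset ι) {P : ι → ℕ → ℝ[X]} {Q : ι → ℝ[X]}
    (h : ∀ i ∈ s, CoeffTendsto (P i) (Q i)) :
    CoeffTendsto (fun n => ∑ i ∈ s, P i n) (∑ i ∈ s, Q i) := fun k => by
  simp only [finsetSum_coeff]
  exact tendsto_finsetSum _ fun i hi => h i hi k

/-- Transport of the limit along an equality of polynomials. [folklore] -/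
lemma CoeffTendsto.congr_right {P : ℕ → ℝ[X]} {Q Q' : ℝ[X]} (h : CoeffTendsto P Q) (hQ : Q = Q') :
    CoeffTendsto P Q' := hQ ▸ h


/-- The Taylor polynomial `∑_{m ≤ M} (-s²)^m/m!` of `e^{-s²}` has `i`-th coefficient
`cᵢ = expNegSqCoeff i` for `i ≤ 2M + 1`. [folklore] -/
lemma coeff_expNegSq_taylor (M i : ℕ) (hi : i ≤ 2 * M + 1) :
    (∑ m ∈ range (M + 1), C (1 / (m ! : ℝ)) * (-X ^ 2) ^ m).coeff i = expNegSqCoeff i := by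
  have hX : ∀ m : ℕ, (-X ^ 2 : ℝ[X]) ^ m = C ((-1 : ℝ) ^ m) * X ^ (2 * m) := fun m => by
    rw [neg_pow, pow_mul, map_pow, map_neg, map_one]
  simp only [hX, ← mul_assoc, ← C_mul, finsetSum_coeff, coeff_C_mul_X_pow]
  unfold expNegSqCoeff
  split_ifs with heven
  · obtain ⟨i', rfl⟩ := heven
    rw [Finset.sum_eq_single i']
    · rw [if_pos (by ring)]
      have : (i' + i') / 2 = i' := by omega
      rw [this]; ring
    · intro m _ hm
      rw [if_neg (by omega)]
    · intro hi'
      exfalso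
      simp [mem_range] at hi'
      omega
  · refine Finset.sum_eq_zero fun m _ => ?_
    rw [if_neg]
    rintro rfl
    exact heven ⟨m, by ring⟩

/-! ### From GORZ's hypothesis (4)/(15) to Theorem 6: Theorem 3 -/

section Theorem3

variable {α A δ : ℕ → ℝ} {d : ℕ} {g : ℕ → ℕ → ℝ}

/-- Auxiliary polynomial for Thm. 3: `G_n(s) = -s² + ∑_{i=3}^{d} (gᵢ(n)/δ(n)^i) sⁱ`, so that
`G_n(δ(n) j) = -δ(n)² j² + ∑ gᵢ(n) jⁱ` is the polynomial part of GORZ's expansion (15) of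
`log(α(n+j)/α(n)) - A(n) j`. [folklore] -/
def logRatioPoly (δ : ℕ → ℝ) (d : ℕ) (g : ℕ → ℕ → ℝ) (n : ℕ) : ℝ[X] :=
  -X ^ 2 + ∑ i ∈ Icc 3 d, C (g i n / δ n ^ i) * X ^ i

/-- Auxiliary polynomial for Thm. 3: the truncated exponential `Q_n(s) = ∑_{m ≤ d} G_n(s)^m/m!` of
`logRatioPoly`; its coefficients are the `Cᵢ(n)` fed to Thm. 6. [folklore] -/
def expLogRatioPoly (δ : ℕ → ℝ) (d : ℕ) (g : ℕ → ℕ → ℝ) (n : ℕ) : ℝ[X] :=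
  ∑ m ∈ range (d + 1), C (1 / (m ! : ℝ)) * (logRatioPoly δ d g n) ^ m

/-- `G_n(δ(n) x) = -δ(n)² x² + ∑ gᵢ(n) xⁱ` for `δ(n) ≠ 0`. [folklore] -/
lemma eval_logRatioPoly (n : ℕ) (hn : δ n ≠ 0) (x : ℝ) :
    (logRatioPoly δ d g n).eval (δ n * x) = -(δ n ^ 2 * x ^ 2) + ∑ i ∈ Icc 3 d, g i n * x ^ i := by
  simp only [logRatioPoly, eval_add, eval_neg, eval_pow, eval_X, eval_finsetSum, eval_mul, eval_C]
  congr 1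
  · ring
  · refine Finset.sum_congr rfl fun i _ => ?_
    rw [mul_pow, ← mul_assoc, div_mul_cancel₀ _ (pow_ne_zero _ hn)]

/-- `Q_n(x) = ∑_{m ≤ d} G_n(x)^m/m!`. [folklore] -/
lemma eval_expLogRatioPoly (n : ℕ) (x : ℝ) :
    (expLogRatioPoly δ d g n).eval x =
      ∑ m ∈ range (d + 1), ((logRatioPoly δ d g n).eval x) ^ m / m ! := by
  simp only [expLogRatioPoly, eval_finsetSum, eval_mul, eval_C, eval_pow]
  exact Finset.sum_congr rfl fun m _ => by ring

/-- `deg G_n ≤ d + 2`. [folklore] -/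
lemma natDegree_logRatioPoly_le (n : ℕ) : (logRatioPoly δ d g n).natDegree ≤ d + 2 := by
  unfold logRatioPoly
  refine (natDegree_add_le _ _).trans (max_le ?_ ?_)
  · rw [natDegree_neg, natDegree_pow, natDegree_X]; omega
  · refine natDegree_sum_le_of_forall_le _ _ fun i hi => ?_
    refine (natDegree_C_mul_X_pow_le _ _).trans ?_
    have := (Finset.mem_Icc.mp hi).2; omega

/-- `deg Q_n ≤ (d + 2) d`. [folklore] -/
lemma natDegree_expLogRatioPoly_le (n : ℕ) : (expLogRatioPoly δ d g n).natDegree ≤ (d + 2) * d := by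
  unfold expLogRatioPoly
  refine natDegree_sum_le_of_forall_le _ _ fun m hm => ?_
  refine (natDegree_C_mul_le _ _).trans (natDegree_pow_le.trans ?_)
  have hm' : m ≤ d := Nat.lt_succ_iff.mp (mem_range.mp hm)
  calc m * (logRatioPoly δ d g n).natDegree
      ≤ d * (d + 2) := Nat.mul_le_mul hm' (natDegree_logRatioPoly_le n)
    _ = (d + 2) * d := Nat.mul_comm _ _

/-- `G_n → -s²` coefficientwise, since `gᵢ(n)/δ(n)^i → 0`. [folklore] -/
lemma coeffTendsto_logRatioPoly (hg : ∀ i, 3 ≤ i → i ≤ d → (g i) =o[atTop] fun n => δ n ^ i) :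
    CoeffTendsto (logRatioPoly δ d g) (-X ^ 2) := by
  have h : CoeffTendsto (logRatioPoly δ d g) (-X ^ 2 + ∑ i ∈ Icc 3 d, C 0 * X ^ i) := by
    refine (CoeffTendsto.const _).add (CoeffTendsto.sum _ fun i hi => ?_)
    have hi' := Finset.mem_Icc.mp hi
    exact (CoeffTendsto.of_C ((hg i hi'.1 hi'.2).tendsto_div_nhds_zero)).mul
      (CoeffTendsto.const _)
  refine h.congr_right ?_
  simp

/-- `Q_n → ∑_{m ≤ d} (-s²)^m/m!` coefficientwise. [folklore] -/
lemma coeffTendsto_expLogRatioPoly (hg : ∀ i, 3 ≤ i → i ≤ d → (g i) =o[atTop] fun n => δ n ^ i) :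
    CoeffTendsto (expLogRatioPoly δ d g) (∑ m ∈ range (d + 1), C (1 / (m ! : ℝ)) * (-X ^ 2) ^ m) :=
  CoeffTendsto.sum _ fun m _ => (CoeffTendsto.const _).mul ((coeffTendsto_logRatioPoly hg).pow m)

end Theorem3

section Theorem3Proof

variable {α A δ : ℕ → ℝ} {d : ℕ} {g : ℕ → ℕ → ℝ}

/-- The bridge from GORZ's logarithmic hypothesis (4)/(15) to hypothesis (8) of Thm. 6: if
`log(α(n+j)/α(n)) = A(n) j - δ(n)² j² + ∑_{i=3}^{d} gᵢ(n) jⁱ + o(δ(n)^d)` with `gᵢ(n) = o(δ(n)^i)`,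
`α > 0`, `δ(n) → 0`, then `α(n+j)/α(n) e^{-A(n) j} = ∑_{i ≤ d} [sⁱ]Q_n · δ(n)^i jⁱ + o(δ(n)^d)`.
Proof: exponentiate; `e^{L} - 1 = O(L)`, the Taylor remainder of `exp` at order `d + 1` is
`O(u^{d+1}) = O(δ^{2d+2})`, and the coefficients of `Q_n` above degree `d` contribute `O(δ^{d+1})`.
[folklore] -/
lemma isLittleO_expLogRatio_sub_taylor (hα : ∀ n, 0 < α n) (hδ0 : ∀ᶠ n in atTop, δ n ≠ 0)
    (hδ : Tendsto δ atTop (𝓝 0))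
    (hg : ∀ i, 3 ≤ i → i ≤ d → (g i) =o[atTop] fun n => δ n ^ i) (j : ℕ)
    (h : (fun n => Real.log (α (n + j) / α n) -
        (A n * j - δ n ^ 2 * (j : ℝ) ^ 2 + ∑ i ∈ Icc 3 d, g i n * (j : ℝ) ^ i)) =o[atTop]
        fun n => δ n ^ d) :
    (fun n => α (n + j) / α n * (Real.exp (A n))⁻¹ ^ j -
        ∑ i ∈ range (d + 1), (expLogRatioPoly δ d g n).coeff i * δ n ^ i * (j : ℝ) ^ i) =o[atTop]
      fun n => δ n ^ d := by
  -- the exponent `u n` and the logarithmic remainder `L n`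
  obtain ⟨u, hu_def⟩ : ∃ u : ℕ → ℝ, ∀ n,
      u n = -(δ n ^ 2 * (j : ℝ) ^ 2) + ∑ i ∈ Icc 3 d, g i n * (j : ℝ) ^ i := ⟨_, fun _ => rfl⟩
  obtain ⟨L, hL_def⟩ : ∃ L : ℕ → ℝ, ∀ n, L n = Real.log (α (n + j) / α n) -
      (A n * j - δ n ^ 2 * (j : ℝ) ^ 2 + ∑ i ∈ Icc 3 d, g i n * (j : ℝ) ^ i) := ⟨_, fun _ => rfl⟩
  have hL : L =o[atTop] fun n => δ n ^ d := h.congr_left fun n => (hL_def n).symm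
  -- (F0) the ratio is `exp (u + L)`
  have hF0 : ∀ n, α (n + j) / α n * (Real.exp (A n))⁻¹ ^ j = Real.exp (u n) * Real.exp (L n) := by
    intro n
    have hratio : 0 < α (n + j) / α n := div_pos (hα _) (hα _)
    rw [← Real.exp_add, show u n + L n = Real.log (α (n + j) / α n) - (j : ℝ) * A n by
      rw [hu_def, hL_def]; ring, Real.exp_sub, Real.exp_log hratio, Real.exp_nat_mul]
    ring
  -- `u → 0` and `u = O(δ²)`
  have hu0 : Tendsto u atTop (𝓝 0) := by
    have h1 : Tendsto (fun n => -(δ n ^ 2 * (j : ℝ) ^ 2) + ∑ i ∈ Icc 3 d, g i n * (j : ℝ) ^ i)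
        atTop (𝓝 (-(0 ^ 2 * (j : ℝ) ^ 2) + ∑ i ∈ Icc 3 d, 0 * (j : ℝ) ^ i)) := by
      refine ((hδ.pow 2).mul_const _).neg.add (tendsto_finsetSum _ fun i hi => ?_)
      have hi' := Finset.mem_Icc.mp hi
      have hgi : Tendsto (g i) atTop (𝓝 0) :=
        (hg i hi'.1 hi'.2).trans_tendsto (by simpa [show i ≠ 0 by omega] using hδ.pow i)
      exact hgi.mul_const _
    simp only [ne_eq, OfNat.ofNat_ne_zero, not_false_eq_true, zero_pow, zero_mul, neg_zero,
      Finset.sum_const_zero, add_zero] at h1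
    exact h1.congr fun n => (hu_def n).symm
  have hδ2 : ∀ i, 2 ≤ i → (fun n => δ n ^ i) =O[atTop] fun n => δ n ^ 2 := by
    intro i hi
    have hb : (fun n => δ n ^ (i - 2)) =O[atTop] (fun _ => (1 : ℝ)) := (hδ.pow (i - 2)).isBigO_one ℝ
    refine ((isBigO_refl (fun n => δ n ^ 2) atTop).mul hb).congr (fun n => ?_) (fun n => ?_)
    · rw [← pow_add, Nat.add_sub_cancel' hi]
    · rw [mul_one]
  have hu2 : u =O[atTop] fun n => δ n ^ 2 := by
    have h1 : (fun n => -(δ n ^ 2 * (j : ℝ) ^ 2)) =O[atTop] fun n => δ n ^ 2 :=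
      ((isBigO_refl (fun n => δ n ^ 2) atTop).const_mul_left (-(j : ℝ) ^ 2)).congr_left
        fun n => by ring
    have h2 : ∀ i ∈ Icc 3 d, (fun n => g i n * (j : ℝ) ^ i) =O[atTop] fun n => δ n ^ 2 := by
      intro i hi
      have hi' := Finset.mem_Icc.mp hi
      have := ((hg i hi'.1 hi'.2).isBigO.trans (hδ2 i (by omega))).const_mul_left ((j : ℝ) ^ i)
      exact this.congr_left fun n => by ring
    exact (h1.add (IsBigO.sum h2)).congr_left fun n => (hu_def n).symm
  -- (F1) `exp u · (exp L - 1) = o(δ^d)`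
  have hL0 : Tendsto L atTop (𝓝 0) :=
    (isLittleO_one_iff ℝ).mp (hL.trans_isBigO ((hδ.pow d).isBigO_one ℝ))
  have hexpu : (fun n => Real.exp (u n)) =O[atTop] (fun _ => (1 : ℝ)) :=
    ((Real.continuous_exp.tendsto 0).comp hu0).isBigO_one ℝ
  have hexpL : (fun n => Real.exp (L n) - 1) =O[atTop] L := by
    refine IsBigO.of_bound 2 ?_
    filter_upwards [(hL0.abs).eventually_le_const (u := 1) (by simp)] with n hn
    simpa [Real.norm_eq_abs] using Real.abs_exp_sub_one_le hn
  have hF1 : (fun n => Real.exp (u n) * (Real.exp (L n) - 1)) =o[atTop] fun n => δ n ^ d :=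
    (hexpu.mul_isLittleO (hexpL.trans_isLittleO hL)).congr_right fun n => one_mul _
  -- (F2) the Taylor remainder of `exp` at order `d + 1`
  have hF2 : (fun n => Real.exp (u n) - ∑ m ∈ range (d + 1), u n ^ m / m !) =o[atTop]
      fun n => δ n ^ d := by
    have hbound : (fun n => Real.exp (u n) - ∑ m ∈ range (d + 1), u n ^ m / m !) =O[atTop]
        fun n => u n ^ (d + 1) := by
      refine IsBigO.of_bound ((d + 1).succ / ((d + 1)! * (d + 1) : ℕ) : ℝ) ?_
      filter_upwards [(hu0.abs).eventually_le_const (u := 1) (by simp)] with n hn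
      rw [Real.norm_eq_abs, Real.norm_eq_abs, abs_pow, mul_comm]
      have := Real.exp_bound hn (Nat.succ_pos d)
      convert this using 2
      push_cast; ring
    have hsmall : (fun n => (δ n ^ 2) ^ (d + 1)) =o[atTop] fun n => δ n ^ d := by
      have h0 : Tendsto (fun n => δ n ^ (d + 2)) atTop (𝓝 0) := by simpa using hδ.pow (d + 2)
      refine ((isBigO_refl (fun n => δ n ^ d) atTop).mul_isLittleO
        ((isLittleO_one_iff ℝ).mpr h0 : (fun n => δ n ^ (d + 2)) =o[atTop] fun _ => (1 : ℝ))).congr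
        (fun n => by ring) (fun n => by ring)
    exact hbound.trans_isLittleO ((hu2.pow (d + 1)).trans_isLittleO hsmall)
  -- (F3) the higher Taylor coefficients of `Q_n`
  set B := (d + 2) * d with hB
  obtain ⟨q, hq⟩ : ∃ q : ℕ → ℝ,
      ∀ i, Tendsto (fun n => (expLogRatioPoly δ d g n).coeff i) atTop (𝓝 (q i)) :=
    ⟨_, coeffTendsto_expLogRatioPoly hg⟩
  have hF3 : (fun n => ∑ i ∈ Ico (d + 1) (B + 1),
      (expLogRatioPoly δ d g n).coeff i * δ n ^ i * (j : ℝ) ^ i) =o[atTop] fun n => δ n ^ d := by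
    refine IsLittleO.sum fun i hi => ?_
    have hid : d + 1 ≤ i := (Finset.mem_Ico.mp hi).1
    refine isLittleO_iff_exists_eq_mul.mpr
      ⟨fun n => (expLogRatioPoly δ d g n).coeff i * (j : ℝ) ^ i * δ n ^ (i - d), ?_,
        Eventually.of_forall fun n => ?_⟩
    · have h0 : Tendsto (fun n => δ n ^ (i - d)) atTop (𝓝 0) := by
        simpa [show i - d ≠ 0 by omega] using hδ.pow (i - d)
      simpa using ((hq i).mul_const ((j : ℝ) ^ i)).mul h0
    · simp only [Pi.mul_apply]
      rw [show δ n ^ i = δ n ^ (i - d) * δ n ^ d by rw [← pow_add, Nat.sub_add_cancel (by omega)]]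
      ring
  -- the identity `ρ - ∑_{i ≤ d} qᵢ(n) δⁱ jⁱ = F1 + F2 + F3`, eventually
  refine ((hF1.add hF2).add hF3).congr' ?_ EventuallyEq.rfl
  filter_upwards [hδ0] with n hn
  have hQ : ∑ m ∈ range (d + 1), u n ^ m / m ! =
      ∑ i ∈ range (d + 1), (expLogRatioPoly δ d g n).coeff i * δ n ^ i * (j : ℝ) ^ i +
        ∑ i ∈ Ico (d + 1) (B + 1), (expLogRatioPoly δ d g n).coeff i * δ n ^ i * (j : ℝ) ^ i := by
    have h1 : u n = (logRatioPoly δ d g n).eval (δ n * j) := by rw [eval_logRatioPoly n hn, hu_def]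
    rw [h1, ← eval_expLogRatioPoly,
      eval_eq_sum_range' (Nat.lt_succ_of_le (natDegree_expLogRatioPoly_le n)),
      ← sum_range_add_sum_Ico _ (show d + 1 ≤ B + 1 by rw [hB]; nlinarith)]
    simp only [mul_pow, mul_assoc]
  rw [hF0, hQ]
  ring

/-- **GORZ, Theorem 3** (PNAS 116 (2019), Thm. 3) in the strengthened form actually used in
§5.1, eq. (15): if `α(n) > 0`, `0 < δ(n) → 0` for large `n`, `gᵢ(n) = o(δ(n)^i)` (`3 ≤ i ≤ d`) and
`log(α(n+j)/α(n)) = A(n) j - δ(n)² j² + ∑_{i=3}^{d} gᵢ(n) jⁱ + o(δ(n)^d)` for all `0 ≤ j ≤ d`, then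
`δ(n)^{-d}/α(n) · J^{d,n}_α((δ(n) X - 1)/exp(A(n)))` converges coefficientwise to the Hermite
polynomial `H_d(X)`. (Eq. (15) is not literally hypothesis (4) of Thm. 3, whose error term
`o(δ(n)^d)` would have to absorb the `gᵢ(n) jⁱ = o(δ(n)^i)`; the reduction to Thm. 6 —
`isLittleO_expLogRatio_sub_taylor` — handles (15) directly.) [cite: GORZPNAS2019, Thm. 3] -/
theorem tendsto_coeff_jensenPolyRescaled_gorzHermite' (hα : ∀ n, 0 < α n)
    (hδ0 : ∀ᶠ n in atTop, 0 < δ n) (hδ : Tendsto δ atTop (𝓝 0))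
    (hg : ∀ i, 3 ≤ i → i ≤ d → (g i) =o[atTop] fun n => δ n ^ i)
    (h : ∀ j : ℕ, j ≤ d → (fun n => Real.log (α (n + j) / α n) -
        (A n * j - δ n ^ 2 * (j : ℝ) ^ 2 + ∑ i ∈ Icc 3 d, g i n * (j : ℝ) ^ i)) =o[atTop]
        fun n => δ n ^ d) (k : ℕ) :
    Tendsto (fun n => (jensenPolyRescaled α (fun n => Real.exp (A n)) δ d n).coeff k) atTop
      (𝓝 ((gorzHermite d).coeff k)) := by
  have hδ0' : ∀ᶠ n in atTop, δ n ≠ 0 := hδ0.mono fun n hn => hn.ne'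
  refine tendsto_coeff_jensenPolyRescaled (E := fun n => Real.exp (A n))
    (Cn := fun i n => (expLogRatioPoly δ d g n).coeff i) (c := expNegSqCoeff) hδ0' hδ
    (fun i hi => ?_) (fun j hj => ?_) k
  · have := coeffTendsto_expLogRatioPoly hg i
    rwa [coeff_expNegSq_taylor d i (by omega)] at this
  · exact isLittleO_expLogRatio_sub_taylor hα hδ0' hδ hg j (h j hj)

/-- **GORZ, Theorem 3** as printed (PNAS 116 (2019), Thm. 3): if `α(n) > 0`, `0 < δ(n) → 0` and
`log(α(n+j)/α(n)) = A(n) j - δ(n)² j² + o(δ(n)^d)` for `0 ≤ j ≤ d`, then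
`lim_n δ(n)^{-d}/α(n) · J^{d,n}_α((δ(n) X - 1)/exp(A(n))) = H_d(X)` coefficientwise (equivalently,
locally uniformly in `X`). We allow any real `A(n)` and require `δ(n) > 0` only for large `n`.
[cite: GORZPNAS2019, Thm. 3] -/
theorem tendsto_coeff_jensenPolyRescaled_gorzHermite (hα : ∀ n, 0 < α n)
    (hδ0 : ∀ᶠ n in atTop, 0 < δ n) (hδ : Tendsto δ atTop (𝓝 0))
    (h : ∀ j : ℕ, j ≤ d → (fun n => Real.log (α (n + j) / α n) -
        (A n * j - δ n ^ 2 * (j : ℝ) ^ 2)) =o[atTop] fun n => δ n ^ d) (k : ℕ) :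
    Tendsto (fun n => (jensenPolyRescaled α (fun n => Real.exp (A n)) δ d n).coeff k) atTop
      (𝓝 ((gorzHermite d).coeff k)) := by
  refine tendsto_coeff_jensenPolyRescaled_gorzHermite' (g := fun _ _ => 0) hα hδ0 hδ
    (fun i _ _ => isLittleO_zero _ _) ?_ k
  intro j hj
  simpa using h j hj


/-! ### The Corollary: eventual hyperbolicity -/

/-- **GORZ, Theorem 3**, conclusion (5) in the printed form: under the hypotheses of Theorem 3,
`δ(n)^{-d}/α(n) · J^{d,n}_α((δ(n) X - 1)/exp(A(n))) → H_d(X)` uniformly for `X` in compact subsets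
of `ℝ` (locally uniformly). [cite: GORZPNAS2019, Thm. 3 eq. (5)] -/
theorem tendstoLocallyUniformly_jensenPolyRescaled_gorzHermite (hα : ∀ n, 0 < α n)
    (hδ0 : ∀ᶠ n in atTop, 0 < δ n) (hδ : Tendsto δ atTop (𝓝 0))
    (h : ∀ j : ℕ, j ≤ d → (fun n => Real.log (α (n + j) / α n) -
        (A n * j - δ n ^ 2 * (j : ℝ) ^ 2)) =o[atTop] fun n => δ n ^ d) :
    TendstoLocallyUniformly
      (fun n x => (jensenPolyRescaled α (fun n => Real.exp (A n)) δ d n).eval x)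
      (fun x => (gorzHermite d).eval x) atTop :=
  tendstoLocallyUniformly_eval_of_tendsto_coeff
    (fun n => natDegree_jensenPolyRescaled_le α _ δ d n) (natDegree_gorzHermite d).le
    (tendsto_coeff_jensenPolyRescaled_gorzHermite hα hδ0 hδ h)

end Theorem3Proof

section Corollary

/-- Hyperbolicity transfers from the renormalised polynomial back to `J^{d,n}_α` (an invertible
affine substitution and a nonzero scalar). [folklore] -/
lemma splits_jensenPoly_of_splits_rescaled {α E δ : ℕ → ℝ} {d n : ℕ} (hα : α n ≠ 0)
    (hE : E n ≠ 0) (hδ : δ n ≠ 0) (h : (jensenPolyRescaled α E δ d n).Splits) :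
    (jensenPoly α d n).Splits := by
  have hc : (δ n)⁻¹ ^ d / α n ≠ 0 := div_ne_zero (pow_ne_zero _ (inv_ne_zero hδ)) hα
  have hlin : (C (δ n / E n) * X - C (E n)⁻¹).natDegree = 1 := by
    rw [natDegree_sub_C, natDegree_C_mul_X _ (div_ne_zero hδ hE)]
  rw [splits_iff_comp_splits_of_natDegree_eq_one hlin]
  have : (jensenPoly α d n).comp (C (δ n / E n) * X - C (E n)⁻¹) =
      C ((δ n)⁻¹ ^ d / α n)⁻¹ * jensenPolyRescaled α E δ d n := by
    rw [jensenPolyRescaled, ← mul_assoc, ← C_mul, inv_mul_cancel₀ hc, C_1, one_mul]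
  rw [this]
  exact h.C_mul _

/-- **GORZ, Corollary to Theorem 3** (PNAS 116 (2019), §1, Corollary) for the strengthened
hypothesis (15): the Jensen polynomials `J^{d,n}_α` are hyperbolic for all sufficiently large `n`.
Proof as printed: `H_d` has `d` simple real zeros (`gorzHermite_eq_prod_roots`), a property stable
under small perturbation of the coefficients (`eventually_splits_of_tendsto_coeff`).
[cite: GORZPNAS2019, §1 Corollary] -/
theorem jensenPoly_eventually_splits' {α A δ : ℕ → ℝ} {d : ℕ} {g : ℕ → ℕ → ℝ} (hα : ∀ n, 0 < α n)
    (hδ0 : ∀ᶠ n in atTop, 0 < δ n) (hδ : Tendsto δ atTop (𝓝 0))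
    (hg : ∀ i, 3 ≤ i → i ≤ d → (g i) =o[atTop] fun n => δ n ^ i)
    (h : ∀ j : ℕ, j ≤ d → (fun n => Real.log (α (n + j) / α n) -
        (A n * j - δ n ^ 2 * (j : ℝ) ^ 2 + ∑ i ∈ Icc 3 d, g i n * (j : ℝ) ^ i)) =o[atTop]
        fun n => δ n ^ d) :
    ∃ N : ℕ, ∀ n : ℕ, N ≤ n → (jensenPoly α d n).Splits := by
  obtain ⟨r, hr, hH⟩ := gorzHermite_eq_prod_roots d
  have hlim : ∀ k, Tendsto (fun n => (jensenPolyRescaled α (fun n => Real.exp (A n)) δ d n).coeff k)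
      atTop (𝓝 ((C (1 : ℝ) * ∏ i, (X - C (r i))).coeff k)) := fun k => by
    rw [C_1, one_mul, ← hH]
    exact tendsto_coeff_jensenPolyRescaled_gorzHermite' hα hδ0 hδ hg h k
  have hev := eventually_splits_of_tendsto_coeff hr one_ne_zero
    (fun n => natDegree_jensenPolyRescaled_le α _ δ d n) hlim
  obtain ⟨N, hN⟩ := eventually_atTop.mp (hev.and hδ0)
  refine ⟨N, fun n hn => ?_⟩
  obtain ⟨⟨hs, -⟩, hδn⟩ := hN n hn
  exact splits_jensenPoly_of_splits_rescaled (hα n).ne' (Real.exp_pos _).ne' hδn.ne' hs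

/-- **GORZ, Corollary to Theorem 3** as printed (PNAS 116 (2019), §1, Corollary): under the
hypotheses of Theorem 3 the Jensen polynomials `J^{d,n}_α` are hyperbolic for all but finitely many
`n`. [cite: GORZPNAS2019, §1 Corollary] -/
theorem jensenPoly_eventually_splits {α A δ : ℕ → ℝ} {d : ℕ} (hα : ∀ n, 0 < α n)
    (hδ0 : ∀ᶠ n in atTop, 0 < δ n) (hδ : Tendsto δ atTop (𝓝 0))
    (h : ∀ j : ℕ, j ≤ d → (fun n => Real.log (α (n + j) / α n) -
        (A n * j - δ n ^ 2 * (j : ℝ) ^ 2)) =o[atTop] fun n => δ n ^ d) :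
    ∃ N : ℕ, ∀ n : ℕ, N ≤ n → (jensenPoly α d n).Splits := by
  refine jensenPoly_eventually_splits' (A := A) (g := fun _ _ => 0) hα hδ0 hδ
    (fun i _ _ => isLittleO_zero _ _) ?_
  intro j hj
  simpa using h j hj

/-! ### The analytic input for `ζ` (GORZ §4–§5) as a named fact, and Theorem 1 conditionally -/

/-- NAMED FACT (**GORZ, PNAS 116 (2019), §5.1, eq. (15)**, established there from the
saddle-point asymptotics to all orders of Thm. 7 for `F(n) = ∫₁^∞ (log t)^n t^{-3/4} θ₀(t) dt` via
eqs. (13), (14), (16), (17)): for every degree `d ≥ 1` there are sequences `A(n)`, `δ(n)` with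
`0 < δ(n) → 0` for large `n`, and `gᵢ(n) = o(δ(n)^i)` (`3 ≤ i ≤ d`), such that for all `0 ≤ j ≤ d`
`log(γ(n+j)/γ(n)) = A(n) j - δ(n)² j² + ∑_{i=3}^{d} gᵢ(n) jⁱ + o(δ(n)^d)`, where
`γ = xiTaylorCoeff` are the Taylor coefficients of `(-1 + 4z²) Λ(1/2 + z)` (GORZ eq. (1)). The paper
also gives leading-order closed forms (18) for `δ(n)`, `A(n)` (`δ(n)² = 1/ñ - 2/(L² K)`,
`ñ = 2n - 2`, `L` the positive root of `ñ = L(π e^L + 3/4)`, `K = (L⁻¹ + L⁻²) ñ - 3/4`); this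
statement only asserts existence, which is what Thm. 1 consumes, so it is weaker than the printed
claim. Meaningful together with `xiTaylorCoeff_pos` (`γ(n) > 0`, GORZ §1).
Users take `(h : xiTaylorCoeff_logRatio)`.
[cite: GORZPNAS2019, §5.1 eq. (15)] -/
def xiTaylorCoeff_logRatio : Prop :=
  ∀ d : ℕ, 1 ≤ d → ∃ (A δ : ℕ → ℝ) (g : ℕ → ℕ → ℝ),
    (∀ᶠ n in atTop, 0 < δ n) ∧ Tendsto δ atTop (𝓝 0) ∧
    (∀ i, 3 ≤ i → i ≤ d → (g i) =o[atTop] fun n => δ n ^ i) ∧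
    ∀ j : ℕ, j ≤ d → (fun n => Real.log (xiTaylorCoeff (n + j) / xiTaylorCoeff n) -
        (A n * j - δ n ^ 2 * (j : ℝ) ^ 2 + ∑ i ∈ Icc 3 d, g i n * (j : ℝ) ^ i)) =o[atTop]
        fun n => δ n ^ d

/-- **GORZ, Theorem 1** (PNAS 116 (2019), Thm. 1: for `d ≥ 1`, `J^{d,n}_γ` is hyperbolic for all
sufficiently large `n`), proved from the two named facts the printed proof (§5.1) rests on:
positivity `γ(n) > 0` (`xiTaylorCoeff_pos`, GORZ §1) and the expansion (15)
(`xiTaylorCoeff_logRatio`, GORZ §5.1), via Theorem 3 and its Corollary. This is exactly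
`Literature.NumberTheory.LFunctions.gorz_eventually` of `Literature/NumberTheory/LFunctions/Equivalents.lean`, unfolded.
[cite: GORZPNAS2019, Thm. 1] -/
theorem jensenPoly_xiTaylorCoeff_eventually_splits (hpos : xiTaylorCoeff_pos)
    (h : xiTaylorCoeff_logRatio) (d : ℕ) (hd : 1 ≤ d) :
    ∃ N : ℕ, ∀ n : ℕ, N ≤ n → (jensenPoly xiTaylorCoeff d n).Splits := by
  obtain ⟨A, δ, g, hδ0, hδ, hg, hlog⟩ := h d hd
  exact jensenPoly_eventually_splits' hpos hδ0 hδ hg hlog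

end Corollary

end Literature.NumberTheory.LFunctions
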